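import Literature.Topology.FourManifolds.FishtailIotaTwo
import HarnessLib

/-!
# The fishtail end in `X^σ` is a local diffeomorphism (second cylinder)

Infrastructure for the explicit fishtail neighbourhood (R. Gompf, *More Cappell–Shaneson spheres
are standard*, Algebr. Geom. Topol. 10 (2010), proof of Thm 2.1 and Lemma 2.2; the named fact
`Literature.Topology.FourManifolds.gompf2010_framedTwist`). `FishtailIotaTwo.lean` defines the
end map `iotaTwo` on the second cylinder `T³ × ℝ` of the fishtail end model (pieces: box shell,
corner, hole = tube about Gompf's disc, glued along the distance to the hole). Here we prove that
it is a local diffeomorphism at every point of the model end `{im z₁ > 0}` (depth `e ∈ (0, E₁)`),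
under hypotheses on the parameters collected in `IotaData.LocHyp`:

* `Literature.Topology.FourManifolds.modelExp E₁ θ₀ n_j (e, n, ℓ, s)` — real coordinates of the
  model end (`z₁ = e^{i arccos(1 - 2e/E₁)}`, `z₂ = e^{i(n + θ₀ - n_j)}`, `z₃ = e^{iℓ}`), a local
  diffeomorphism onto `{im z₁ > 0}`;
* the three windows through `modelExp` are `physX ∘ (real box shell)`, `physX ∘ (corner map)`,
  `tubeD ∘ (handle identification)`, hence local diffeomorphisms
  (`isLocalDiffeomorphAt_boxP`, `isLocalDiffeomorphAt_cornerP`, `isLocalDiffeomorphAt_holeP`);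
* `Literature.Topology.FourManifolds.IotaData.isLocalDiffeomorphAt_iotaTwo`.

Everything is proved; no named facts.

## References

* R. E. Gompf, *More Cappell–Shaneson spheres are standard*, Algebr. Geom. Topol. 10 (2010)
  1665–1681, proof of Thm 2.1 and Lemma 2.2. [GompfAGT2010]
-/

noncomputable section

open scoped Real ContDiff Topology Manifold
open Set Function Filter Complex Metric

namespace Literature.Topology.FourManifolds

local notation "𝔼 " n:arg => EuclideanSpace ℝ (Fin n)
local notation "𝓣" =>
  (ModelWithCorners.prod (𝓡 1) (ModelWithCorners.prod (𝓡 1) (𝓡 1)))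

/-! ### Generic: local diffeomorphisms through a local diffeomorphism; glue on an open set -/

section Generic

variable {E₁ H₁ E₂ H₂ E₃ H₃ : Type*}
  [NormedAddCommGroup E₁] [NormedSpace ℝ E₁] [TopologicalSpace H₁]
  [NormedAddCommGroup E₂] [NormedSpace ℝ E₂] [TopologicalSpace H₂]
  [NormedAddCommGroup E₃] [NormedSpace ℝ E₃] [TopologicalSpace H₃]
  {I₁ : ModelWithCorners ℝ E₁ H₁} {I₂ : ModelWithCorners ℝ E₂ H₂} {I₃ : ModelWithCorners ℝ E₃ H₃}
  {M₁ : Type*} [TopologicalSpace M₁] [ChartedSpace H₁ M₁]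
  {M₂ : Type*} [TopologicalSpace M₂] [ChartedSpace H₂ M₂]
  {M₃ : Type*} [TopologicalSpace M₃] [ChartedSpace H₃ M₃]

/-- **A map is a local diffeomorphism at `f x` if it is one after precomposition with a local
diffeomorphism `f` at `x`.** [folklore] -/
theorem isLocalDiffeomorphAt_of_comp_left {f : M₁ → M₂} {g : M₂ → M₃} {x : M₁}
    (hf : IsLocalDiffeomorphAt I₁ I₂ ∞ f x) (h : IsLocalDiffeomorphAt I₁ I₃ ∞ (g ∘ f) x) :
    IsLocalDiffeomorphAt I₂ I₃ ∞ g (f x) := by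
  have h1 := hf.localInverse_isLocalDiffeomorphAt
  have hx : hf.localInverse (f x) = x := hf.localInverse_left_inv hf.localInverse_mem_target
  have h2 : IsLocalDiffeomorphAt I₁ I₃ ∞ (g ∘ f) (hf.localInverse (f x)) := by rw [hx]; exact h
  have h3 := h1.comp (K := I₃) (P := M₃) h2
  refine isLocalDiffeomorphAt_congr_nhds' h3 ?_
  filter_upwards [hf.localInverse_eventuallyEq_right] with y hy
  simp only [comp_apply, id_eq] at hy ⊢
  rw [hy]

variable {Q : Type*} [TopologicalSpace Q] [ChartedSpace H₁ Q] {N : Type*} [TopologicalSpace N] [ChartedSpace H₂ N]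
  {τ : Q → ℝ} {s : ℝ} {f g : Q → N}

omit [ChartedSpace H₁ Q] [TopologicalSpace N] [ChartedSpace H₂ N] in
/-- The glued map is locally `g` where `s ≤ τ` on a neighbourhood. [folklore] -/
theorem glueBy_eventuallyEq_right_of {q : Q} (h : ∀ᶠ q' in 𝓝 q, s ≤ τ q') : glueBy τ s f g =ᶠ[𝓝 q] g := by
  filter_upwards [h] with q' hq'
  exact glueBy_of_le hq'

/-- **The glued map is a local diffeomorphism** at `q ∈ S`, `S` open, `τ` continuous on `S`, the
pieces agreeing on the slab `|τ - s| < δ` inside `S`. [folklore] -/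
theorem isLocalDiffeomorphAt_glueBy_of_continuousOn {S : Set Q} (hS : IsOpen S) (hτ : ContinuousOn τ S) {δ : ℝ}
    (hδ : 0 < δ) {q : Q} (hq : q ∈ S) (hfg : ∀ q' ∈ S, |τ q' - s| < δ → f q' = g q')
    (hf : τ q < s → IsLocalDiffeomorphAt I₁ I₂ ∞ f q) (hg : s - δ < τ q → IsLocalDiffeomorphAt I₁ I₂ ∞ g q) :
    IsLocalDiffeomorphAt I₁ I₂ ∞ (glueBy τ s f g) q := by
  have hpre : ∀ U : Set ℝ, IsOpen U → IsOpen (S ∩ τ ⁻¹' U) := fun U hU ↦ hτ.isOpen_inter_preimage hS hU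
  rcases lt_or_ge (τ q) (s - δ / 2) with hl | hr
  · have ho : IsOpen (S ∩ τ ⁻¹' Iio s) := hpre _ isOpen_Iio
    exact isLocalDiffeomorphAt_congr_nhds' (hf (by linarith))
      (eventuallyEq_of_mem (ho.mem_nhds ⟨hq, show τ q < s by linarith⟩) fun q' hq' ↦ glueBy_of_lt hq'.2)
  · refine isLocalDiffeomorphAt_congr_nhds' (hg (by linarith)) ?_
    rcases lt_or_ge (τ q) (s + δ / 2) with hm | hbig
    · have ho : IsOpen (S ∩ τ ⁻¹' Ioo (s - δ) (s + δ)) := hpre _ isOpen_Ioo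
      filter_upwards [ho.mem_nhds ⟨hq, show τ q ∈ Ioo (s - δ) (s + δ) from ⟨by linarith, by linarith⟩⟩] with q' hq'
      rcases lt_or_ge (τ q') s with hl' | hr'
      · rw [glueBy_of_lt hl', hfg q' hq'.1 (abs_lt.2 ⟨by linarith [hq'.2.1], by linarith [hq'.2.2]⟩)]
      · exact glueBy_of_le hr'
    · have ho : IsOpen (S ∩ τ ⁻¹' Ioi s) := hpre _ isOpen_Ioi
      exact eventuallyEq_of_mem (ho.mem_nhds ⟨hq, show s < τ q by linarith⟩) fun q' hq' ↦ glueBy_of_le (le_of_lt hq'.2)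

variable {F : Type*} [NormedAddCommGroup F] [NormedSpace ℝ F]

/-- Translation by a constant vector, a diffeomorphism. [folklore] -/
def addConstDiffeo (v : F) : F ≃ₘ⟮𝓘(ℝ, F), 𝓘(ℝ, F)⟯ F where
  toFun w := w + v
  invFun w := w - v
  left_inv w := by simp
  right_inv w := by simp
  contMDiff_toFun := contMDiff_iff_contDiff.2 (contDiff_id.add contDiff_const)
  contMDiff_invFun := contMDiff_iff_contDiff.2 (contDiff_id.sub contDiff_const)

/-- The value of the translation. [folklore] -/
@[simp] theorem addConstDiffeo_apply (v w : F) : addConstDiffeo v w = w + v := rfl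

end Generic

/-! ### Real coordinates of the model end -/

section ModelExp

variable (E₁ θ₀ nj : ℝ)

/-- **Real coordinates of the model end**: `(e, n, ℓ, s) ↦ ((e^{i arccos(1 - 2e/E₁)}, e^{i(n + θ₀ - n_j)}, e^{iℓ}), s)`. [folklore] -/
def modelExp (q : ℝ × ℝ × ℝ × ℝ) : ThreeTorus × ℝ :=
  (expT (WithLp.toLp 2 ![Real.arccos (1 - 2 * q.1 / E₁), q.2.1 + θ₀ - nj, q.2.2.1]), q.2.2.2)

/-- The real part of the model angles map. [folklore] -/
def modelAngles (q : ℝ × ℝ × ℝ × ℝ) : (𝔼 3) × ℝ :=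
  (WithLp.toLp 2 ![Real.arccos (1 - 2 * q.1 / E₁), q.2.1 + θ₀ - nj, q.2.2.1], q.2.2.2)

variable {E₁ θ₀ nj}

/-- `modelExp = (expT × id) ∘ modelAngles`. [folklore] -/
theorem modelExp_eq (q : ℝ × ℝ × ℝ × ℝ) : modelExp E₁ θ₀ nj q = Prod.map expT id (modelAngles E₁ θ₀ nj q) := rfl

/-- The components of `modelExp`. [folklore] -/
theorem modelExp_fst_fst (q : ℝ × ℝ × ℝ × ℝ) : (modelExp E₁ θ₀ nj q).1.1 = Circle.exp (Real.arccos (1 - 2 * q.1 / E₁)) := by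
  simp [modelExp, expT]

/-- The `z₂` coordinate of the model exponential. [folklore] -/
theorem modelExp_fst_snd_fst (q : ℝ × ℝ × ℝ × ℝ) : (modelExp E₁ θ₀ nj q).1.2.1 = Circle.exp (q.2.1 + θ₀ - nj) := by
  simp [modelExp, expT]

/-- The `z₃` coordinate of the model exponential. [folklore] -/
theorem modelExp_fst_snd_snd (q : ℝ × ℝ × ℝ × ℝ) : (modelExp E₁ θ₀ nj q).1.2.2 = Circle.exp q.2.2.1 := by
  simp [modelExp, expT]

/-- The base coordinate of the model exponential. [folklore] -/
@[simp] theorem modelExp_snd (q : ℝ × ℝ × ℝ × ℝ) : (modelExp E₁ θ₀ nj q).2 = q.2.2.2 := rfl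

/-- The real part of `z₁` is `1 - 2e/E₁` for `0 ≤ e ≤ E₁` (`0 < E₁`). [folklore] -/
theorem re_modelExp_fst_fst (hE : 0 < E₁) {q : ℝ × ℝ × ℝ × ℝ} (h0 : 0 ≤ q.1) (h1 : q.1 ≤ E₁) :
    ((modelExp E₁ θ₀ nj q).1.1 : ℂ).re = 1 - 2 * q.1 / E₁ := by
  rw [modelExp_fst_fst, Circle.coe_exp, Complex.exp_ofReal_mul_I_re, Real.cos_arccos]
  · have : 2 * q.1 / E₁ ≤ 2 := by rw [div_le_iff₀ hE]; linarith
    linarith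
  · have : 0 ≤ 2 * q.1 / E₁ := by positivity
    linarith

/-- The imaginary part of `z₁` is positive for `0 < e < E₁`. [folklore] -/
theorem im_modelExp_fst_fst_pos (hE : 0 < E₁) {q : ℝ × ℝ × ℝ × ℝ} (h0 : 0 < q.1) (h1 : q.1 < E₁) :
    0 < ((modelExp E₁ θ₀ nj q).1.1 : ℂ).im := by
  rw [modelExp_fst_fst, Circle.coe_exp, Complex.exp_ofReal_mul_I_im]
  refine Real.sin_pos_of_pos_of_lt_pi (Real.arccos_pos.2 ?_) ((Real.arccos_le_pi _).lt_of_ne ?_)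
  · have : 0 < 2 * q.1 / E₁ := by positivity
    linarith
  · rw [Ne, Real.arccos_eq_pi]
    have : 2 * q.1 / E₁ < 2 := by rw [div_lt_iff₀ hE]; linarith
    linarith

/-- **`modelAngles` is a local diffeomorphism** at `0 < e < E₁`. [folklore] -/
theorem isLocalDiffeomorphAt_modelAngles (hE : 0 < E₁) {q : ℝ × ℝ × ℝ × ℝ} (h0 : 0 < q.1) (h1 : q.1 < E₁) :
    IsLocalDiffeomorphAt 𝓘(ℝ, ℝ × ℝ × ℝ × ℝ) 𝓘(ℝ, (𝔼 3) × ℝ) ∞ (modelAngles E₁ θ₀ nj) q := by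
  -- `modelAngles = L ∘ (graph of e ↦ arccos (1 - 2e/E₁) over (n, ℓ, s)) ∘ swap`
  let Sw : (ℝ × ℝ × ℝ × ℝ) ≃L[ℝ] ((ℝ × ℝ × ℝ) × ℝ) :=
    { toFun := fun q ↦ (q.2, q.1)
      invFun := fun p ↦ (p.2, p.1)
      map_add' := fun _ _ ↦ rfl
      map_smul' := fun _ _ ↦ rfl
      left_inv := fun _ ↦ rfl
      right_inv := fun _ ↦ rfl
      continuous_toFun := by fun_prop
      continuous_invFun := by fun_prop }
  let L : ((ℝ × ℝ × ℝ) × ℝ) ≃L[ℝ] ((𝔼 3) × ℝ) :=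
    { toFun := fun p ↦ (WithLp.toLp 2 ![p.2, p.1.1, p.1.2.1], p.1.2.2)
      invFun := fun r ↦ ((r.1 1, r.1 2, r.2), r.1 0)
      map_add' := fun a b ↦ by
        refine Prod.ext ?_ rfl
        ext j; fin_cases j <;> simp
      map_smul' := fun c a ↦ by
        refine Prod.ext ?_ rfl
        ext j; fin_cases j <;> simp
      left_inv := fun p ↦ by simp
      right_inv := fun r ↦ by
        refine Prod.ext ?_ rfl
        ext j; fin_cases j <;> simp
      continuous_toFun := by
        refine Continuous.prodMk ?_ (by fun_prop)
        refine (PiLp.continuous_toLp 2 _).comp ?_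
        refine continuous_pi fun j ↦ ?_
        fin_cases j <;> simp <;> fun_prop
      continuous_invFun := by
        have hc : ∀ j, Continuous fun r : (𝔼 3) × ℝ ↦ r.1 j := fun j ↦ (PiLp.continuous_apply 2 _ j).comp continuous_fst
        fun_prop }
  -- the translation of `n` by `θ₀ - n_j`
  have hTr := (addConstDiffeo ((0, θ₀ - nj, 0, 0) : ℝ × ℝ × ℝ × ℝ)).isLocalDiffeomorph q
  have hTrq : addConstDiffeo ((0, θ₀ - nj, 0, 0) : ℝ × ℝ × ℝ × ℝ) q = (q.1, q.2.1 + (θ₀ - nj), q.2.2) := by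
    obtain ⟨e, n, l, s⟩ := q; simp
  have hSw := Sw.toDiffeomorph.isLocalDiffeomorph (q.1, q.2.1 + (θ₀ - nj), q.2.2)
  set a : ℝ → ℝ := fun e ↦ Real.arccos (1 - 2 * e / E₁) with ha
  have hU : IsOpen {p : (ℝ × ℝ × ℝ) × ℝ | p.2 ∈ Ioo 0 E₁} := isOpen_Ioo.preimage continuous_snd
  have hmem : Sw (q.1, q.2.1 + (θ₀ - nj), q.2.2) ∈ {p : (ℝ × ℝ × ℝ) × ℝ | p.2 ∈ Ioo 0 E₁} := ⟨h0, h1⟩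
  have hin : ∀ e ∈ Ioo 0 E₁, -1 < 1 - 2 * e / E₁ ∧ 1 - 2 * e / E₁ < 1 := fun e he ↦ by
    constructor
    · have : 2 * e / E₁ < 2 := by rw [div_lt_iff₀ hE]; linarith [he.2]
      linarith
    · have : 0 < 2 * e / E₁ := by have := he.1; positivity
      linarith
  have haff : ∀ e, HasDerivAt (fun e : ℝ ↦ 1 - 2 * e / E₁) (-(2 / E₁)) e := fun e ↦
    (((hasDerivAt_id e).const_mul 2).div_const E₁).const_sub 1 |>.congr_deriv (by simp)
  have hderiv : ∀ e ∈ Ioo 0 E₁, HasDerivAt a (-(1 / Real.sqrt (1 - (1 - 2 * e / E₁) ^ 2)) * (-(2 / E₁))) e :=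
    fun e he ↦ by
      rw [ha]
      exact HasDerivAt.comp (h₂ := Real.arccos) (h := fun e : ℝ ↦ 1 - 2 * e / E₁) e
        (Real.hasDerivAt_arccos (hin e he).1.ne' (hin e he).2.ne) (haff e)
  have hcd : ContDiffOn ℝ ∞ (fun p : (ℝ × ℝ × ℝ) × ℝ ↦ a p.2) {p | p.2 ∈ Ioo 0 E₁} := by
    intro p hp
    have h := (Real.contDiffAt_arccos (hin p.2 hp).1.ne' (hin p.2 hp).2.ne).comp p
      ((contDiffAt_const.sub ((contDiffAt_const.mul contDiffAt_snd).div_const E₁)) : ContDiffAt ℝ ∞ (fun p : (ℝ × ℝ × ℝ) × ℝ ↦ 1 - 2 * p.2 / E₁) p)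
    exact h.contDiffWithinAt
  have hc : -(1 / Real.sqrt (1 - (1 - 2 * q.1 / E₁) ^ 2)) * (-(2 / E₁)) ≠ 0 := by
    have hs : 0 < Real.sqrt (1 - (1 - 2 * q.1 / E₁) ^ 2) := by
      apply Real.sqrt_pos.2
      obtain ⟨hl, hr⟩ := hin q.1 ⟨h0, h1⟩
      nlinarith
    exact mul_ne_zero (neg_ne_zero.2 (one_div_ne_zero hs.ne')) (neg_ne_zero.2 (div_ne_zero two_ne_zero hE.ne'))
  have hG : IsLocalDiffeomorphAt 𝓘(ℝ, (ℝ × ℝ × ℝ) × ℝ) 𝓘(ℝ, (ℝ × ℝ × ℝ) × ℝ) ∞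
      (fun p : (ℝ × ℝ × ℝ) × ℝ ↦ (p.1, a p.2)) (Sw (q.1, q.2.1 + (θ₀ - nj), q.2.2)) :=
    isLocalDiffeomorphAt_graph_real hU hmem hcd (by exact_mod_cast le_top) hc (hderiv q.1 ⟨h0, h1⟩)
  have hL := L.toDiffeomorph.isLocalDiffeomorph ((Sw (q.1, q.2.1 + (θ₀ - nj), q.2.2)).1, a (Sw (q.1, q.2.1 + (θ₀ - nj), q.2.2)).2)
  have hSG := (hSw.comp (K := 𝓘(ℝ, (ℝ × ℝ × ℝ) × ℝ)) (P := (ℝ × ℝ × ℝ) × ℝ) hG).comp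
    (K := 𝓘(ℝ, (𝔼 3) × ℝ)) (P := (𝔼 3) × ℝ) hL
  rw [← hTrq] at hSG
  have h := hTr.comp (K := 𝓘(ℝ, (𝔼 3) × ℝ)) (P := (𝔼 3) × ℝ) hSG
  refine isLocalDiffeomorphAt_congr_nhds' h (Eventually.of_forall fun q' ↦ ?_)
  obtain ⟨e', n', l', s'⟩ := q'
  simp only [modelAngles, comp_apply]
  refine Prod.ext ?_ (by simp [L, Sw])
  ext j
  fin_cases j <;> simp [L, Sw, ha]
  ring

/-- **`modelExp` is a local diffeomorphism** at `0 < e < E₁`. [folklore] -/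
theorem isLocalDiffeomorphAt_modelExp (hE : 0 < E₁) {q : ℝ × ℝ × ℝ × ℝ} (h0 : 0 < q.1) (h1 : q.1 < E₁) :
    IsLocalDiffeomorphAt 𝓘(ℝ, ℝ × ℝ × ℝ × ℝ) (ModelWithCorners.prod 𝓣 𝓘(ℝ, ℝ)) ∞ (modelExp E₁ θ₀ nj) q := by
  have h1' := isLocalDiffeomorphAt_modelAngles (θ₀ := θ₀) (nj := nj) hE h0 h1
  have h2 : IsLocalDiffeomorphAt (𝓘(ℝ, 𝔼 3).prod 𝓘(ℝ, ℝ)) (ModelWithCorners.prod 𝓣 𝓘(ℝ, ℝ)) ∞ (Prod.map expT id)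
      (modelAngles E₁ θ₀ nj q) :=
    IsLocalDiffeomorphAt.prodMap' (isLocalDiffeomorphAt_expT _) ((Diffeomorph.refl 𝓘(ℝ, ℝ) ℝ ∞).isLocalDiffeomorph _)
  rw [← modelWithCornersSelf_prod, chartedSpaceSelf_prod] at h2
  exact h1'.comp (K := ModelWithCorners.prod 𝓣 𝓘(ℝ, ℝ)) (P := ThreeTorus × ℝ) h2

/-- **Every point of the model end is in the image**: for `im z₁ > 0` the point `(x, s)` is
`modelExp (e, n, ℓ, s)` with `e = E₁ (1 - re z₁)/2 ∈ (0, E₁)`, `n = arg z₂ - θ₀ + n_j`,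
`ℓ = arg z₃`. [folklore] -/
theorem modelExp_of_im_pos (hE : 0 < E₁) {x : ThreeTorus} (hx : 0 < (x.1 : ℂ).im) (s : ℝ) :
    modelExp E₁ θ₀ nj (E₁ * (1 - (x.1 : ℂ).re) / 2, arg (x.2.1 : ℂ) - θ₀ + nj, arg (x.2.2 : ℂ), s) = (x, s) ∧
      0 < E₁ * (1 - (x.1 : ℂ).re) / 2 ∧ E₁ * (1 - (x.1 : ℂ).re) / 2 < E₁ := by
  have hn : ‖(x.1 : ℂ)‖ = 1 := x.1.norm_coe
  have hsq : (x.1 : ℂ).re ^ 2 + (x.1 : ℂ).im ^ 2 = 1 := by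
    have h := Complex.sq_norm (x.1 : ℂ)
    rw [hn, Complex.normSq_apply] at h
    nlinarith [h]
  have hre1 : (x.1 : ℂ).re < 1 := by nlinarith
  have hre2 : -1 < (x.1 : ℂ).re := by nlinarith
  refine ⟨?_, by nlinarith, by nlinarith⟩
  have harg : 1 - 2 * (E₁ * (1 - (x.1 : ℂ).re) / 2) / E₁ = (x.1 : ℂ).re := by field_simp; ring
  refine Prod.ext (Prod.ext ?_ (Prod.ext ?_ ?_)) rfl
  · rw [modelExp_fst_fst, harg]
    apply Subtype.ext
    rw [Circle.coe_exp]
    apply Complex.ext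
    · rw [Complex.exp_ofReal_mul_I_re, Real.cos_arccos hre2.le hre1.le]
    · rw [Complex.exp_ofReal_mul_I_im, Real.sin_arccos]
      have : 1 - (x.1 : ℂ).re ^ 2 = (x.1 : ℂ).im ^ 2 := by nlinarith
      rw [this, Real.sqrt_sq hx.le]
  · rw [modelExp_fst_snd_fst, show arg (x.2.1 : ℂ) - θ₀ + nj + θ₀ - nj = arg (x.2.1 : ℂ) by ring, Circle.exp_arg]
  · rw [modelExp_fst_snd_snd, Circle.exp_arg]

end ModelExp

/-! ### The physical point map, again -/

section PhysX

variable {ε : ℝ} (hε : 0 < ε) (hε2 : ε ≤ 1 / 2)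

/-- `e^{iy} ≠ 1` for `0 < y < 2π`. [folklore] -/
theorem circleExp_ne_one_of_mem {y : ℝ} (h0 : 0 < y) (h1 : y < 2 * π) : Circle.exp y ≠ 1 := by
  intro h
  rw [Circle.exp_eq_one] at h
  obtain ⟨m, hm⟩ := h
  have hπ := Real.pi_pos
  rcases lt_trichotomy m 0 with hneg | hzero | hpos
  · have : (m : ℝ) ≤ -1 := by exact_mod_cast Int.le_sub_one_iff.2 hneg
    nlinarith
  · rw [hzero] at hm; simp at hm; linarith
  · have : (1 : ℝ) ≤ m := by exact_mod_cast hpos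
    nlinarith

/-- `e^{-2πi} = 1`. [folklore] -/
theorem circleExp_neg_two_pi : Circle.exp (-(2 * π)) = 1 := by
  rw [Circle.exp_neg, Circle.exp_two_pi, inv_one]

/-- **The physical point map is a local diffeomorphism** at `(n, y, ℓ, t)` with `0 < t < 3/2` and
`0 < y < 2π` (the point is off the section circle because its second coordinate is not `1`). [folklore] -/
theorem isLocalDiffeomorphAt_physX' {q : ℝ × ℝ × ℝ × ℝ} (ht0 : 0 < q.2.2.2) (ht1 : q.2.2.2 < 3 / 2)
    (hy0 : 0 < q.2.1) (hy1 : q.2.1 < 2 * π) :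
    IsLocalDiffeomorphAt 𝓘(ℝ, ℝ × ℝ × ℝ × ℝ) 𝓘(ℝ, 𝔼 4) ∞ (physX hε hε2) q := by
  have h1 : IsLocalDiffeomorphAt 𝓘(ℝ, ℝ × ℝ × ℝ × ℝ) 𝓘(ℝ, (𝔼 3) × ℝ) ∞ physAssemble q := physAssemble.isLocalDiffeomorph q
  have h2 : IsLocalDiffeomorphAt 𝓘(ℝ, (𝔼 3) × ℝ) 𝓘(ℝ, 𝔼 4) ∞ (mtCoord tubeShearDiffeo) (physAssemble q) := by
    have h := isLocalDiffeomorphAt_mtCoord (ψ := tubeShearDiffeo) (q := physAssemble q) (by simpa using ht0) (by simpa using ht1)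
    rw [← modelWithCornersSelf_prod, chartedSpaceSelf_prod] at h
    exact h
  have hmem : mtCoord tubeShearDiffeo (physAssemble q) ∈ (fishNu hε hε2).complement := by
    rw [mtCoord]
    refine mtPt_mem_complement hε hε2 ?_ (by simpa using ht0) (by simpa using ht1)
    intro h
    have h2 : (expT (physAssemble q).1).2.1 = 1 := by rw [h]; rfl
    rw [expT_physAssemble] at h2
    exact circleExp_ne_one_of_mem hy0 hy1 h2
  exact (h1.comp (K := 𝓘(ℝ, 𝔼 4)) (P := MTorus tubeShearDiffeo) h2).comp (K := 𝓘(ℝ, 𝔼 4))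
    (P := (fishNu hε hε2).Surgered) (isLocalDiffeomorphAt_toSurg (ν := fishNu hε hε2) hmem)

/-- The value of the physical point map. [folklore] -/
theorem physX_apply (q : ℝ × ℝ × ℝ × ℝ) : physX hε hε2 q = toSurg (fishNu hε hε2)
    (mtPt tubeShearDiffeo (Circle.exp (q.1 - q.2.2.1), Circle.exp q.2.1, Circle.exp q.2.2.1) q.2.2.2) := by
  rw [physX, mtCoord, expT_physAssemble]
  rfl

end PhysX

/-! ### The box shell window -/

section BoxWindow

/-- **The real box shell map in model coordinates** with gauge `C(n)`:
`(e, n, ℓ, s) ↦ (n, faceY (thetaV s) e, ℓ - C n, faceT (thetaV s) e)`. [folklore] -/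
def boxRealG (C : ℝ → ℝ) (q : ℝ × ℝ × ℝ × ℝ) : ℝ × ℝ × ℝ × ℝ :=
  (q.2.1, faceY (thetaV q.2.2.2) q.1, q.2.2.1 - C q.2.1, faceT (thetaV q.2.2.2) q.1)

/-- **The real box shell map is a local diffeomorphism** for a smooth gauge and depth `e < 1`
(reordering of `isLocalDiffeomorphAt_boxShellMap`). [folklore] -/
theorem isLocalDiffeomorphAt_boxRealG {C : ℝ → ℝ} (hC : ContDiff ℝ ∞ C) {q : ℝ × ℝ × ℝ × ℝ} (he : q.1 < 1) :
    IsLocalDiffeomorphAt 𝓘(ℝ, ℝ × ℝ × ℝ × ℝ) 𝓘(ℝ, ℝ × ℝ × ℝ × ℝ) ∞ (boxRealG C) q := by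
  -- `boxRealG C = P₂ ∘ boxShellMap C' ∘ translate ∘ Lin₁`
  let Lin₁ : (ℝ × ℝ × ℝ × ℝ) ≃L[ℝ] (ℝ × ℝ × ℝ × ℝ) :=
    { toFun := fun q ↦ (q.2.1, q.2.2.1, -(2 * π) * q.2.2.2, q.1)
      invFun := fun p ↦ (p.2.2.2, p.1, p.2.1, -(2 * π)⁻¹ * p.2.2.1)
      map_add' := fun a b ↦ by simp; ring
      map_smul' := fun c a ↦ by simp; ring
      left_inv := fun q ↦ by
        obtain ⟨e, n, l, s⟩ := q
        simp only [Prod.mk.injEq, true_and]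
        field_simp
      right_inv := fun p ↦ by
        obtain ⟨n, l, θ, e⟩ := p
        simp only [Prod.mk.injEq, true_and, and_true]
        field_simp
      continuous_toFun := by fun_prop
      continuous_invFun := by fun_prop }
  let P₂ : (ℝ × ℝ × ℝ × ℝ) ≃L[ℝ] (ℝ × ℝ × ℝ × ℝ) :=
    { toFun := fun p ↦ (p.1, p.2.2.2, p.2.1, p.2.2.1)
      invFun := fun p ↦ (p.1, p.2.2.1, p.2.2.2, p.2.1)
      map_add' := fun _ _ ↦ rfl
      map_smul' := fun _ _ ↦ rfl
      left_inv := fun _ ↦ rfl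
      right_inv := fun _ ↦ rfl
      continuous_toFun := by fun_prop
      continuous_invFun := by fun_prop }
  set v₀ : ℝ × ℝ × ℝ × ℝ := (0, 0, π / 2 + 2 * π, 0) with hv₀
  have hθ : ∀ s' : ℝ, -(2 * π * s') + (π / 2 + 2 * π) = thetaV s' := fun s' ↦ by rw [thetaV]; ring
  have h1 := Lin₁.toDiffeomorph.isLocalDiffeomorph q
  have h2 := (addConstDiffeo v₀).isLocalDiffeomorph (Lin₁ q)
  have hpt : addConstDiffeo v₀ (Lin₁ q) = (q.2.1, q.2.2.1, thetaV q.2.2.2, q.1) := by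
    obtain ⟨e, n, l, s'⟩ := q
    simp [Lin₁, hv₀, hθ]
  have h3 : IsLocalDiffeomorphAt 𝓘(ℝ, ℝ × ℝ × ℝ × ℝ) 𝓘(ℝ, ℝ × ℝ × ℝ × ℝ) ∞ (boxShellMap fun n _ _ ↦ C n)
      (addConstDiffeo v₀ (Lin₁ q)) := by
    rw [hpt]
    exact isLocalDiffeomorphAt_boxShellMap (C := fun n _ _ ↦ C n) (hC.comp contDiff_fst) (by exact he)
  have h4 := P₂.toDiffeomorph.isLocalDiffeomorph (boxShellMap (fun n _ _ ↦ C n) (addConstDiffeo v₀ (Lin₁ q)))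
  have h := ((h1.comp (K := 𝓘(ℝ, ℝ × ℝ × ℝ × ℝ)) (P := ℝ × ℝ × ℝ × ℝ) h2).comp
    (K := 𝓘(ℝ, ℝ × ℝ × ℝ × ℝ)) (P := ℝ × ℝ × ℝ × ℝ) h3).comp (K := 𝓘(ℝ, ℝ × ℝ × ℝ × ℝ)) (P := ℝ × ℝ × ℝ × ℝ) h4
  refine isLocalDiffeomorphAt_congr_nhds' h (Eventually.of_forall fun q' ↦ ?_)
  obtain ⟨e, n, l, s'⟩ := q'
  simp [boxRealG, boxShellMap, Lin₁, P₂, hv₀, hθ]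

namespace IotaData

variable (J : IotaData)

/-- The model chart of the data. [folklore] -/
abbrev mexp : ℝ × ℝ × ℝ × ℝ → ThreeTorus × ℝ := modelExp J.E₁ J.θ₀ J.nj

/-- The depth of a model point. [folklore] -/
theorem depth_mexp (hE : 0 < J.E₁) {q : ℝ × ℝ × ℝ × ℝ} (h0 : 0 ≤ q.1) (h1 : q.1 ≤ J.E₁) : J.depth (J.mexp q).1.1 = q.1 := by
  rw [depth, re_modelExp_fst_fst hE h0 h1]
  field_simp
  ring

/-- The exponential of the vanishing-cycle coordinate. [folklore] -/
theorem exp_lat_mexp (q : ℝ × ℝ × ℝ × ℝ) : Circle.exp (J.lat (J.mexp q).1.2.1) = Circle.exp q.2.1 := by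
  rw [lat, show arg ((J.mexp q).1.2.1 : ℂ) - J.θ₀ + J.nj = arg ((J.mexp q).1.2.1 : ℂ) + (J.nj - J.θ₀) by ring,
    Circle.exp_add, Circle.exp_arg, modelExp_fst_snd_fst, ← Circle.exp_add]
  ring_nf

/-- The vanishing-cycle coordinate of a model point with principal angle. [folklore] -/
theorem lat_mexp {q : ℝ × ℝ × ℝ × ℝ} (h : q.2.1 + J.θ₀ - J.nj ∈ Ioc (-π) π) : J.lat (J.mexp q).1.2.1 = q.2.1 := by
  rw [lat, modelExp_fst_snd_fst, Circle.arg_exp h.1 h.2]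
  ring

/-- **The box shell through the model chart, trivial clutching twist**:
`boxP = physX ∘ boxRealG 0`. [folklore] -/
theorem boxP_mexp_of_twist (hE : 0 < J.E₁) {q : ℝ × ℝ × ℝ × ℝ} (h0 : 0 ≤ q.1) (h1 : q.1 ≤ J.E₁)
    (htw : J.twistC (J.lat (J.mexp q).1.2.1) q.2.2.2 = 1) :
    J.boxP (J.mexp q).1 q.2.2.2 = physX J.hε J.hε2 (boxRealG (fun _ ↦ 0) q) := by
  rw [boxP, htw, physX_apply, J.depth_mexp hE h0 h1]
  simp only [boxRealG, mul_one, sub_zero]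
  rw [modelExp_fst_snd_snd, J.exp_lat_mexp, Circle.exp_sub, div_eq_mul_inv]

/-- **The box shell through the model chart above the hole**: `boxP = physX ∘ boxRealG C`,
`C n = 2π τ̂_w(n - n_j)`, at base `s > 1` and principal angle. [folklore] -/
theorem boxP_mexp_of_one_lt (hE : 0 < J.E₁) {q : ℝ × ℝ × ℝ × ℝ} (h0 : 0 ≤ q.1) (h1 : q.1 ≤ J.E₁) (hs : 1 < q.2.2.2)
    (hn : q.2.1 + J.θ₀ - J.nj ∈ Ioc (-π) π) :
    J.boxP (J.mexp q).1 q.2.2.2 = physX J.hε J.hε2 (boxRealG (fun n ↦ 2 * π * stepW J.wS (n - J.nj)) q) := by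
  rw [boxP, physX_apply, J.depth_mexp hE h0 h1, J.lat_mexp hn, twistC, if_neg (not_le.2 hs)]
  simp only [boxRealG]
  rw [modelExp_fst_snd_snd, Circle.exp_sub q.2.1, Circle.exp_sub, div_eq_mul_inv, div_eq_mul_inv, ← Circle.exp_neg]

/-- The clutching twist is trivial below the face: `s' < 1` near `(x, s)` when `s < 1`. [folklore] -/
theorem twist_eventually_one_of_lt {x : ThreeTorus} {s : ℝ} (hs : s < 1) :
    ∀ᶠ p in 𝓝 (x, s), J.twistC (J.lat p.1.2.1) p.2 = 1 := by
  have ho : IsOpen {p : ThreeTorus × ℝ | p.2 < 1} := isOpen_lt continuous_snd continuous_const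
  filter_upwards [ho.mem_nhds (show (x, s) ∈ {p : ThreeTorus × ℝ | p.2 < 1} from hs)] with p hp
  rw [twistC, if_pos (le_of_lt hp)]

/-- `re (z e^{-iθ₀}) = cos (arg z - θ₀)` on the circle. [folklore] -/
theorem re_mul_exp_neg (z : Circle) (θ₀ : ℝ) : ((z : ℂ) * exp (-(θ₀ * I))).re = Real.cos (arg (z : ℂ) - θ₀) := by
  conv_lhs => rw [← Circle.exp_arg z]
  rw [Circle.coe_exp, ← Complex.exp_add, show (arg (z : ℂ) : ℂ) * I + -(θ₀ * I) = ((arg (z : ℂ) - θ₀ : ℝ) : ℂ) * I by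
    push_cast; ring, Complex.exp_ofReal_mul_I_re]

/-- **The clutching twist is trivial away from the strip**: if `re (z₂ e^{-iθ₀}) < cos w` at the
point (`0 < w ≤ π`), then near it `|arg z₂ - θ₀| ≥ w`, so `τ̂_w ∈ {0, 1}` and the twist is `1`. [folklore] -/
theorem twist_eventually_one_of_re_lt (hw : 0 < J.wS) (hwπ : J.wS ≤ π) {x : ThreeTorus} {s : ℝ}
    (h : ((x.2.1 : ℂ) * exp (-(J.θ₀ * I))).re < Real.cos J.wS) :
    ∀ᶠ p in 𝓝 (x, s), J.twistC (J.lat p.1.2.1) p.2 = 1 := by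
  have hc : Continuous fun p : ThreeTorus × ℝ ↦ ((p.1.2.1 : ℂ) * exp (-(J.θ₀ * I))).re :=
    continuous_re.comp ((continuous_subtype_val.comp (continuous_fst.comp (continuous_snd.comp continuous_fst))).mul
      continuous_const)
  have ho : IsOpen {p : ThreeTorus × ℝ | ((p.1.2.1 : ℂ) * exp (-(J.θ₀ * I))).re < Real.cos J.wS} := isOpen_lt hc continuous_const
  filter_upwards [ho.mem_nhds (show (x, s) ∈ {p : ThreeTorus × ℝ | _} from h)] with p hp
  have hp' : ((p.1.2.1 : ℂ) * exp (-(J.θ₀ * I))).re < Real.cos J.wS := hp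
  rw [re_mul_exp_neg] at hp'
  -- `|arg z₂ - θ₀| ≥ w`
  have habs : J.wS ≤ |arg (p.1.2.1 : ℂ) - J.θ₀| := by
    by_contra hlt
    rw [not_le] at hlt
    have := Real.cos_lt_cos_of_nonneg_of_le_pi (abs_nonneg _) hwπ hlt
    rw [Real.cos_abs] at this
    linarith
  have hd : J.lat p.1.2.1 - J.nj = arg (p.1.2.1 : ℂ) - J.θ₀ := by rw [lat]; ring
  rw [twistC]
  split_ifs with h1
  · rfl
  · rw [hd]
    rcases le_abs'.1 habs with hl | hr
    · rw [stepW_of_le hw hl, mul_zero, neg_zero, Circle.exp_zero]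
    · rw [stepW_of_ge hw hr, mul_one]; exact circleExp_neg_two_pi

/-- **The box shell is a local diffeomorphism where the clutching twist is locally trivial**
(at a model point `mexp q`, depth `q.1 ∈ (0, E₁)`, `E₁ < 1`). [folklore] -/
theorem isLocalDiffeomorphAt_boxP_mexp_of_twist (hE : 0 < J.E₁) (hE1 : J.E₁ < 1) {q : ℝ × ℝ × ℝ × ℝ}
    (h0 : 0 < q.1) (h1 : q.1 < J.E₁) (htw : ∀ᶠ p in 𝓝 (J.mexp q), J.twistC (J.lat p.1.2.1) p.2 = 1) :
    IsLocalDiffeomorphAt (ModelWithCorners.prod 𝓣 𝓘(ℝ, ℝ)) 𝓘(ℝ, 𝔼 4) ∞ (fun p : ThreeTorus × ℝ ↦ J.boxP p.1 p.2) (J.mexp q) := by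
  have hmq := isLocalDiffeomorphAt_modelExp (θ₀ := J.θ₀) (nj := J.nj) hE h0 h1
  refine isLocalDiffeomorphAt_of_comp_left hmq ?_
  -- `boxP ∘ mexp = physX ∘ boxRealG 0` near `q`
  have hR := isLocalDiffeomorphAt_boxRealG (C := fun _ ↦ (0:ℝ)) contDiff_const (q := q) (by linarith)
  have hP : IsLocalDiffeomorphAt 𝓘(ℝ, ℝ × ℝ × ℝ × ℝ) 𝓘(ℝ, 𝔼 4) ∞ (physX J.hε J.hε2) (boxRealG (fun _ ↦ 0) q) := by
    have hy := faceY_mem (θ := thetaV q.2.2.2) h0.le (h1.le.trans hE1.le)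
    refine isLocalDiffeomorphAt_physX' J.hε J.hε2 ?_ ?_ ?_ ?_
    · show 0 < faceT (thetaV q.2.2.2) q.1
      have := faceT_ge (θ := thetaV q.2.2.2) (h1.le.trans hE1.le); nlinarith [bxH_pos]
    · show faceT (thetaV q.2.2.2) q.1 < 3 / 2
      have := faceT_le (θ := thetaV q.2.2.2) h0.le (h1.le.trans hE1.le); linarith
    · show 0 < faceY (thetaV q.2.2.2) q.1
      linarith [hy.1]
    · show faceY (thetaV q.2.2.2) q.1 < 2 * π
      linarith [hy.2, Real.pi_gt_three]
  have h := hR.comp (K := 𝓘(ℝ, 𝔼 4)) (P := (fishNu J.hε J.hε2).Surgered) hP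
  refine isLocalDiffeomorphAt_congr_nhds' h ?_
  have hev : ∀ᶠ q' in 𝓝 q, J.twistC (J.lat (J.mexp q').1.2.1) (J.mexp q').2 = 1 :=
    hmq.contMDiffAt.continuousAt.eventually htw
  have hev2 : ∀ᶠ q' : ℝ × ℝ × ℝ × ℝ in 𝓝 q, q'.1 ∈ Ioo 0 J.E₁ := (isOpen_Ioo.preimage continuous_fst).mem_nhds ⟨h0, h1⟩
  filter_upwards [hev, hev2] with q' h1' h2'
  exact J.boxP_mexp_of_twist hE h2'.1.le h2'.2.le h1'

/-- **The box shell is a local diffeomorphism above the hole** (at `mexp q` with `s > 1` and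
principal angle `n + θ₀ - n_j ∈ (-π, π)`). [folklore] -/
theorem isLocalDiffeomorphAt_boxP_mexp_of_one_lt (hE : 0 < J.E₁) (hE1 : J.E₁ < 1) {q : ℝ × ℝ × ℝ × ℝ}
    (h0 : 0 < q.1) (h1 : q.1 < J.E₁) (hs : 1 < q.2.2.2) (hn : q.2.1 + J.θ₀ - J.nj ∈ Ioo (-π) π) :
    IsLocalDiffeomorphAt (ModelWithCorners.prod 𝓣 𝓘(ℝ, ℝ)) 𝓘(ℝ, 𝔼 4) ∞ (fun p : ThreeTorus × ℝ ↦ J.boxP p.1 p.2) (J.mexp q) := by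
  have hmq := isLocalDiffeomorphAt_modelExp (θ₀ := J.θ₀) (nj := J.nj) hE h0 h1
  refine isLocalDiffeomorphAt_of_comp_left hmq ?_
  have hC : ContDiff ℝ ∞ fun n ↦ 2 * π * stepW J.wS (n - J.nj) :=
    contDiff_const.mul ((contDiff_stepW J.wS).comp (contDiff_id.sub contDiff_const))
  have hR := isLocalDiffeomorphAt_boxRealG hC (q := q) (by linarith)
  have hP : IsLocalDiffeomorphAt 𝓘(ℝ, ℝ × ℝ × ℝ × ℝ) 𝓘(ℝ, 𝔼 4) ∞ (physX J.hε J.hε2)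
      (boxRealG (fun n ↦ 2 * π * stepW J.wS (n - J.nj)) q) := by
    have hy := faceY_mem (θ := thetaV q.2.2.2) h0.le (h1.le.trans hE1.le)
    refine isLocalDiffeomorphAt_physX' J.hε J.hε2 ?_ ?_ ?_ ?_
    · show 0 < faceT (thetaV q.2.2.2) q.1
      have := faceT_ge (θ := thetaV q.2.2.2) (h1.le.trans hE1.le); nlinarith [bxH_pos]
    · show faceT (thetaV q.2.2.2) q.1 < 3 / 2
      have := faceT_le (θ := thetaV q.2.2.2) h0.le (h1.le.trans hE1.le); linarith
    · show 0 < faceY (thetaV q.2.2.2) q.1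
      linarith [hy.1]
    · show faceY (thetaV q.2.2.2) q.1 < 2 * π
      linarith [hy.2, Real.pi_gt_three]
  have h := hR.comp (K := 𝓘(ℝ, 𝔼 4)) (P := (fishNu J.hε J.hε2).Surgered) hP
  refine isLocalDiffeomorphAt_congr_nhds' h ?_
  have hev1 : ∀ᶠ q' : ℝ × ℝ × ℝ × ℝ in 𝓝 q, q'.2.1 + J.θ₀ - J.nj ∈ Ioo (-π) π := by
    have hc : Continuous fun q' : ℝ × ℝ × ℝ × ℝ ↦ q'.2.1 + J.θ₀ - J.nj := by fun_prop
    exact (isOpen_Ioo.preimage hc).mem_nhds hn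
  have hev2 : ∀ᶠ q' : ℝ × ℝ × ℝ × ℝ in 𝓝 q, q'.1 ∈ Ioo 0 J.E₁ := (isOpen_Ioo.preimage continuous_fst).mem_nhds ⟨h0, h1⟩
  have hev3 : ∀ᶠ q' : ℝ × ℝ × ℝ × ℝ in 𝓝 q, 1 < q'.2.2.2 :=
    (isOpen_lt continuous_const (continuous_snd.comp (continuous_snd.comp continuous_snd))).mem_nhds hs
  filter_upwards [hev1, hev2, hev3] with q' h1' h2' h3'
  exact J.boxP_mexp_of_one_lt hE h2'.1.le h2'.2.le h3' ⟨h1'.1, h1'.2.le⟩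

/-- The same at a point `(x, s)` of the model end, trivial twist. [folklore] -/
theorem isLocalDiffeomorphAt_boxP_of_twist (hE : 0 < J.E₁) (hE1 : J.E₁ < 1) {x : ThreeTorus} {s : ℝ}
    (hx : 0 < (x.1 : ℂ).im) (htw : ∀ᶠ p in 𝓝 (x, s), J.twistC (J.lat p.1.2.1) p.2 = 1) :
    IsLocalDiffeomorphAt (ModelWithCorners.prod 𝓣 𝓘(ℝ, ℝ)) 𝓘(ℝ, 𝔼 4) ∞ (fun p : ThreeTorus × ℝ ↦ J.boxP p.1 p.2) (x, s) := by
  obtain ⟨hq, h0, h1⟩ := modelExp_of_im_pos (θ₀ := J.θ₀) (nj := J.nj) hE hx s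
  have h := J.isLocalDiffeomorphAt_boxP_mexp_of_twist hE hE1
    (q := (J.E₁ * (1 - (x.1 : ℂ).re) / 2, arg (x.2.1 : ℂ) - J.θ₀ + J.nj, arg (x.2.2 : ℂ), s)) h0 h1 (by rw [mexp, hq]; exact htw)
  rwa [mexp, hq] at h

/-- The same at a point `(x, s)` of the model end, `s > 1`, `z₂ ≠ -1`. [folklore] -/
theorem isLocalDiffeomorphAt_boxP_of_one_lt (hE : 0 < J.E₁) (hE1 : J.E₁ < 1) {x : ThreeTorus} {s : ℝ}
    (hx : 0 < (x.1 : ℂ).im) (hs : 1 < s) (hz : (x.2.1 : ℂ) ∈ slitPlane) :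
    IsLocalDiffeomorphAt (ModelWithCorners.prod 𝓣 𝓘(ℝ, ℝ)) 𝓘(ℝ, 𝔼 4) ∞ (fun p : ThreeTorus × ℝ ↦ J.boxP p.1 p.2) (x, s) := by
  obtain ⟨hq, h0, h1⟩ := modelExp_of_im_pos (θ₀ := J.θ₀) (nj := J.nj) hE hx s
  have harg : arg (x.2.1 : ℂ) < π := lt_of_le_of_ne (arg_le_pi _) (mem_slitPlane_iff_arg.1 hz).1
  have hn : (arg (x.2.1 : ℂ) - J.θ₀ + J.nj) + J.θ₀ - J.nj ∈ Ioo (-π) π := by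
    constructor <;> linarith [neg_pi_lt_arg (x.2.1 : ℂ)]
  have h := J.isLocalDiffeomorphAt_boxP_mexp_of_one_lt hE hE1
    (q := (J.E₁ * (1 - (x.1 : ℂ).re) / 2, arg (x.2.1 : ℂ) - J.θ₀ + J.nj, arg (x.2.2 : ℂ), s)) h0 h1 hs hn
  rwa [mexp, hq] at h

/-- **The box shell is a local diffeomorphism off the clutching slit** `{s = 1, |arg z₂ - θ₀| ≤ w}`:
at every point of the model end with `s ≠ 1` or `re (z₂ e^{-iθ₀}) < cos w`
(`0 < w`, `w < π - θ₀`, `w < π + θ₀`... precisely `cos (π - θ₀) < cos w`, i.e. the slit misses `z₂ = -1`). [folklore] -/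
theorem isLocalDiffeomorphAt_boxP (hE : 0 < J.E₁) (hE1 : J.E₁ < 1) (hw : 0 < J.wS) (hwπ : J.wS ≤ π)
    (hθw : Real.cos (π - J.θ₀) < Real.cos J.wS) {x : ThreeTorus} {s : ℝ} (hx : 0 < (x.1 : ℂ).im)
    (h : s ≠ 1 ∨ ((x.2.1 : ℂ) * exp (-(J.θ₀ * I))).re < Real.cos J.wS) :
    IsLocalDiffeomorphAt (ModelWithCorners.prod 𝓣 𝓘(ℝ, ℝ)) 𝓘(ℝ, 𝔼 4) ∞ (fun p : ThreeTorus × ℝ ↦ J.boxP p.1 p.2) (x, s) := by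
  by_cases hre : ((x.2.1 : ℂ) * exp (-(J.θ₀ * I))).re < Real.cos J.wS
  · exact J.isLocalDiffeomorphAt_boxP_of_twist hE hE1 hx (J.twist_eventually_one_of_re_lt hw hwπ hre)
  · have hs : s ≠ 1 := h.resolve_right hre
    rcases lt_or_gt_of_ne hs with hlt | hgt
    · exact J.isLocalDiffeomorphAt_boxP_of_twist hE hE1 hx (J.twist_eventually_one_of_lt hlt)
    · refine J.isLocalDiffeomorphAt_boxP_of_one_lt hE hE1 hx hgt ?_
      -- `z₂ ≠ -1`, else `re (z₂ e^{-iθ₀}) = cos (π - θ₀) < cos w`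
      rw [mem_slitPlane_iff_arg]
      refine ⟨fun hπ ↦ hre ?_, Circle.coe_ne_zero _⟩
      rw [re_mul_exp_neg, hπ]
      exact hθw

end IotaData

end BoxWindow

/-! ### The corner window -/

section CornerWindow

/-- **Bounds for Gompf's bend** (`c > 0`, `p₁ > 0`, `ρ_b, ϱ, e ≥ 0`): `W ≤ max ϱ ρ_b` and
`min (c (ϱ - ρ_b)) 0 ≤ E ≤ e` (`W` is a convex combination of `ϱ` and `ρ_b - e/c`). [folklore] -/
theorem fishBend_bounds {c p₁ ρb : ℝ} (hc : 0 < c) (hp₁ : 0 < p₁) {x : ℝ × ℝ} (hx1 : 0 ≤ x.1) (hx2 : 0 ≤ x.2) :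
    (fishBend c p₁ ρb x).1 ≤ max x.1 ρb ∧ min (c * (x.1 - ρb)) 0 ≤ (fishBend c p₁ ρb x).2 ∧ (fishBend c p₁ ρb x).2 ≤ x.2 := by
  obtain ⟨ρ, e⟩ := x
  simp only at hx1 hx2
  set lam := Real.smoothTransition (-(ρ - ρb + e / c) / p₁) with hlam
  have hl0 : 0 ≤ lam := Real.smoothTransition.nonneg _
  have hl1 : lam ≤ 1 := Real.smoothTransition.le_one _
  have hW : (fishBend c p₁ ρb (ρ, e)).1 = (1 - lam) * ρ + lam * (ρb - e / c) := by
    simp only [fishBend, bendF, ← hlam]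
    field_simp
    ring_nf
  have hE : (fishBend c p₁ ρb (ρ, e)).2 = e + c * (ρ - ρb + e / c) * lam := by
    simp only [fishBend, bendF, ← hlam]
  have hec : 0 ≤ e / c := div_nonneg hx2 hc.le
  have hcq : c * (ρ - ρb + e / c) = c * ρ - c * ρb + e := by field_simp
  rw [hW, hE, hcq]
  rcases le_or_gt 0 (ρ - ρb + e / c) with hq0 | hq0
  · have hlam0 : lam = 0 := Real.smoothTransition.zero_of_nonpos (div_nonpos_of_nonpos_of_nonneg (by linarith) hp₁.le)
    rw [hlam0]
    refine ⟨by simp, ?_, by simp⟩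
    simp only [mul_zero, add_zero]
    exact (min_le_right _ _).trans hx2
  · have hneg : c * ρ - c * ρb + e < 0 := by rw [← hcq]; exact mul_neg_of_pos_of_neg hc hq0
    refine ⟨?_, ?_, ?_⟩
    · have h1 : ρb - e / c ≤ max ρ ρb := (sub_le_self _ hec).trans (le_max_right _ _)
      have h2 : ρ ≤ max ρ ρb := le_max_left _ _
      nlinarith
    · have : (c * ρ - c * ρb + e) * 1 ≤ (c * ρ - c * ρb + e) * lam := mul_le_mul_of_nonpos_left hl1 hneg.le
      refine (min_le_left _ _).trans ?_
      nlinarith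
    · have : (c * ρ - c * ρb + e) * lam ≤ 0 := mul_nonpos_of_nonpos_of_nonneg hneg.le hl0
      linarith

namespace IotaData

variable (J : IotaData)

/-- **The hole coordinate in model coordinates**: `p₀ = (n - n_j) + i (1 - e) h tan (2π(s - 1))`. [folklore] -/
def p0fun (q : ℝ × ℝ × ℝ × ℝ) : ℂ :=
  ((q.2.1 - J.nj : ℝ) : ℂ) + (((1 - q.1) * bxH * Real.tan (2 * π * (q.2.2.2 - 1)) : ℝ) : ℂ) * I

/-- The hole coordinate of a model point. [folklore] -/
theorem holeP0_mexp (hE : 0 < J.E₁) {q : ℝ × ℝ × ℝ × ℝ} (h0 : 0 ≤ q.1) (h1 : q.1 ≤ J.E₁)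
    (hn : q.2.1 + J.θ₀ - J.nj ∈ Ioc (-π) π) : J.holeP0 (J.mexp q).1 q.2.2.2 = J.p0fun q := by
  rw [holeP0, J.lat_mexp hn, J.depth_mexp hE h0 h1, p0fun]

/-- `(e, n, ℓ, s) ↦ (p₀, ℓ, e)`. [folklore] -/
def pmap (q : ℝ × ℝ × ℝ × ℝ) : ℂ × ℝ × ℝ := (J.p0fun q, q.2.2.1, q.1)

/-- The cut-off lift in polar coordinates of `p₀`. [folklore] -/
def liftPolar (ϱ φ : ℝ) : ℝ := J.liftS ((ϱ : ℂ) * exp (φ * I))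

/-- The affine conversion `(ξ, t, L) ↦ (n_j + re ξ, y_h + im ξ, L, t)`. [folklore] -/
def cornerAff (r : ℂ × ℝ × ℝ) : ℝ × ℝ × ℝ × ℝ := (J.nj + r.1.re, J.yh + r.1.im, r.2.2, r.2.1)

/-- **The corner in polar hole coordinates** `(ϱ, φ, ℓ, e)`: `physX ∘ cornerAff ∘ cornerMap`. [folklore] -/
def cornerF (r : ℝ × ℝ × ℝ × ℝ) : (fishNu J.hε J.hε2).Surgered :=
  physX J.hε J.hε2 (J.cornerAff (cornerMap J.cL J.p₁ J.ρbL J.liftPolar r))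

/-- The value of `cornerF`. [folklore] -/
theorem cornerF_apply (r : ℝ × ℝ × ℝ × ℝ) : J.cornerF r = physX J.hε J.hε2
    (J.nj + (((fishBend J.cL J.p₁ J.ρbL (r.1, r.2.2.2)).1 : ℂ) * exp (r.2.1 * I)).re,
      J.yh + (((fishBend J.cL J.p₁ J.ρbL (r.1, r.2.2.2)).1 : ℂ) * exp (r.2.1 * I)).im,
      r.2.2.1 + r.2.1 - J.liftPolar r.1 r.2.1, 1 + (fishBend J.cL J.p₁ J.ρbL (r.1, r.2.2.2)).2 * bxH) := rfl

/-- **`cornerF` is `2π`-periodic in the angle.** [folklore] -/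
theorem cornerF_add_two_pi (ϱ φ : ℝ) (w : ℝ × ℝ) : J.cornerF (ϱ, φ + 2 * π, w) = J.cornerF (ϱ, φ, w) := by
  rw [cornerF_apply, cornerF_apply]
  have he : exp (((φ + 2 * π : ℝ) : ℂ) * I) = exp (φ * I) := by
    rw [show ((φ + 2 * π : ℝ) : ℂ) * I = φ * I + 2 * π * I by push_cast; ring, Complex.exp_add, exp_two_pi_mul_I, mul_one]
  have hl : J.liftPolar ϱ (φ + 2 * π) = J.liftPolar ϱ φ := by rw [liftPolar, liftPolar, he]
  simp only [he, hl]
  rw [show w.1 + (φ + 2 * π) - J.liftPolar ϱ φ = (w.1 + φ - J.liftPolar ϱ φ) + 2 * π by ring, physX_add_two_pi]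

/-- **The corner through the model chart**: `cornerP ∘ mexp = radialForm id cornerF ∘ pmap` at a
model point of depth in `[0, E₁]` and principal angle. [folklore] -/
theorem cornerP_mexp (hE : 0 < J.E₁) {q : ℝ × ℝ × ℝ × ℝ} (h0 : 0 ≤ q.1) (h1 : q.1 ≤ J.E₁)
    (hn : q.2.1 + J.θ₀ - J.nj ∈ Ioc (-π) π) :
    J.cornerP (J.mexp q).1 q.2.2.2 = radialForm id J.cornerF (J.pmap q) := by
  rw [radialForm_apply, cornerF_apply]
  simp only [pmap, id]
  set p := J.p0fun q with hpdef
  have hpol : ((‖p‖ : ℝ) : ℂ) * exp (arg p * I) = p := norm_mul_exp_arg_mul_I p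
  have hlift : J.liftPolar ‖p‖ (arg p) = J.liftS p := by rw [liftPolar, hpol]
  have hW : J.bendWE (J.mexp q).1 q.2.2.2 = fishBend J.cL J.p₁ J.ρbL (‖p‖, q.1) := by
    rw [bendWE, J.holeP0_mexp hE h0 h1 hn, J.depth_mexp hE h0 h1]
  have hu : ((unitC p : Circle) : ℂ) = exp (arg p * I) := by rw [unitC, Circle.coe_exp]
  rw [cornerP, physX_apply]
  simp only
  rw [J.holeP0_mexp hE h0 h1 hn, ← hpdef, hW, hlift, modelExp_fst_snd_snd]
  set W := (fishBend J.cL J.p₁ J.ρbL (‖p‖, q.1)).1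
  have hre : J.nj + W * ((unitC p : Circle) : ℂ).re = J.nj + ((W : ℂ) * exp (arg p * I)).re := by
    rw [hu, re_ofReal_mul]
  have him : J.yh + W * ((unitC p : Circle) : ℂ).im = J.yh + ((W : ℂ) * exp (arg p * I)).im := by
    rw [hu, im_ofReal_mul]
  have hf : Circle.exp q.2.2.1 * unitC p * Circle.exp (-J.liftS p) = Circle.exp (q.2.2.1 + arg p - J.liftS p) := by
    rw [unitC, ← Circle.exp_add, ← Circle.exp_add]; ring_nf
  rw [hre, him, hf, ← div_eq_mul_inv, ← Circle.exp_sub]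

/-- **The cut-off lift is smooth** for `0 < w < rΛ₁ < rΛ₂`. [folklore] -/
theorem contDiff_liftS (hw : 0 < J.wS) (h1 : J.wS < J.rΛ₁) (h12 : J.rΛ₁ < J.rΛ₂) : ContDiff ℝ ∞ J.liftS := by
  refine contDiff_iff_contDiffAt.2 fun v ↦ ?_
  rcases lt_or_ge ‖v‖ J.rΛ₁ with hin | hout
  · have hev : J.liftS =ᶠ[𝓝 v] fun _ ↦ 0 := by
      filter_upwards [(isOpen_lt continuous_norm continuous_const).mem_nhds hin] with u hu
      rw [liftS, capBlend, Real.smoothTransition.zero_of_nonpos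
        (div_nonpos_of_nonpos_of_nonneg (by linarith [hu.le]) (sub_pos.2 h12).le), zero_mul]
    exact contDiffAt_const.congr_of_eventuallyEq hev
  · have hv : v ≠ 0 := by
      intro h; rw [h, norm_zero] at hout; linarith
    have hs : (I * v).re ≠ 0 ∨ J.wS < |(I * v).im| := by
      simp only [mul_re, mul_im, I_re, I_im, zero_mul, one_mul, zero_sub, zero_add, neg_ne_zero]
      by_cases him : v.im = 0
      · right
        have : ‖v‖ = |v.re| := by
          rw [Complex.norm_eq_sqrt_sq_add_sq, him]; simp [Real.sqrt_sq_eq_abs]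
        rw [← this]; linarith
      · exact Or.inl him
    have hβ : ContDiffAt ℝ ∞ (fun u : ℂ ↦ capBlend J.rΛ₁ J.rΛ₂ ‖u‖) v :=
      (Real.smoothTransition.contDiff.comp ((contDiff_id.sub contDiff_const).div_const _)).contDiffAt.comp v
        (contDiffAt_norm ℝ hv)
    have hL : ContDiffAt ℝ ∞ (fun u : ℂ ↦ holeLift J.wS (I * u)) v :=
      (contDiffAt_holeLift hw hs).comp v (contDiffAt_const.mul contDiffAt_id)
    exact hβ.mul (hL.sub contDiffAt_const)

/-- The lift in polar coordinates is smooth. [folklore] -/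
theorem contDiff_liftPolar (hw : 0 < J.wS) (h1 : J.wS < J.rΛ₁) (h12 : J.rΛ₁ < J.rΛ₂) :
    ContDiff ℝ ∞ fun p : ℝ × ℝ ↦ J.liftPolar p.1 p.2 := by
  unfold liftPolar
  exact (J.contDiff_liftS hw h1 h12).comp ((ofRealCLM.contDiff.comp contDiff_fst).mul
    (Complex.contDiff_exp.comp ((ofRealCLM.contDiff.comp contDiff_snd).mul contDiff_const)))

/-- **`cornerF` is a local diffeomorphism** at `(ϱ, φ, ℓ, e)` with `0 < ϱ ≤ 1`, `0 ≤ e < 1`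
(parameters: `0 < c`, `0 < p₁`, `0 < w < rΛ₁ < rΛ₂`, `y_h = c_Y`, `ρ_b ≤ 1`, `c ρ_b < 5`). [folklore] -/
theorem isLocalDiffeomorphAt_cornerF (hc : 0 < J.cL) (hp₁ : 0 < J.p₁) (hw : 0 < J.wS) (h1 : J.wS < J.rΛ₁)
    (h12 : J.rΛ₁ < J.rΛ₂) (hyh : J.yh = cY) (hρb : J.ρbL ≤ 1)
    {r : ℝ × ℝ × ℝ × ℝ} (hlo : -5 < J.cL * (r.1 - J.ρbL)) (hϱ0 : 0 < r.1) (hϱ1 : r.1 ≤ 1) (he0 : 0 ≤ r.2.2.2)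
    (he1 : r.2.2.2 < 1) :
    IsLocalDiffeomorphAt 𝓘(ℝ, ℝ × ℝ × ℝ × ℝ) 𝓘(ℝ, 𝔼 4) ∞ J.cornerF r := by
  have hWge := le_fishBend_fst (ρb := J.ρbL) hc.ne' hp₁ (r.1, r.2.2.2)
  obtain ⟨hWle, hEge, hEle⟩ := fishBend_bounds (ρb := J.ρbL) hc hp₁ (x := (r.1, r.2.2.2)) hϱ0.le he0
  simp only at hWge hWle hEle hEge
  have hE5 : -5 < (fishBend J.cL J.p₁ J.ρbL (r.1, r.2.2.2)).2 := by
    refine lt_of_lt_of_le ?_ hEge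
    exact lt_min hlo (by norm_num)
  set W := (fishBend J.cL J.p₁ J.ρbL (r.1, r.2.2.2)).1 with hWdef
  set E := (fishBend J.cL J.p₁ J.ρbL (r.1, r.2.2.2)).2 with hEdef
  have hW0 : W ≠ 0 := by linarith
  have hW1 : W ≤ 1 := hWle.trans (max_le hϱ1 hρb)
  have h1' := isLocalDiffeomorphAt_cornerMap (p₁ := J.p₁) (ρb := J.ρbL) (S := J.liftPolar) hc.ne' (J.contDiff_liftPolar hw h1 h12)
    (q := r) hW0
  -- the affine conversion
  let Lin : (ℂ × ℝ × ℝ) ≃L[ℝ] (ℝ × ℝ × ℝ × ℝ) :=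
    { toFun := fun p ↦ (p.1.re, p.1.im, p.2.2, p.2.1)
      invFun := fun q ↦ ((q.1 : ℂ) + (q.2.1 : ℂ) * I, q.2.2.2, q.2.2.1)
      map_add' := fun a b ↦ by simp
      map_smul' := fun c a ↦ by simp
      left_inv := fun p ↦ by simp [Complex.re_add_im]
      right_inv := fun q ↦ by simp
      continuous_toFun := by fun_prop
      continuous_invFun := by fun_prop }
  have hAff : ∀ p, J.cornerAff p = addConstDiffeo ((J.nj, J.yh, 0, 0) : ℝ × ℝ × ℝ × ℝ) (Lin p) := fun p ↦ by
    simp [cornerAff, Lin, add_comm]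
  have h2 := Lin.toDiffeomorph.isLocalDiffeomorph (cornerMap J.cL J.p₁ J.ρbL J.liftPolar r)
  have h3 := (addConstDiffeo ((J.nj, J.yh, 0, 0) : ℝ × ℝ × ℝ × ℝ)).isLocalDiffeomorph (Lin (cornerMap J.cL J.p₁ J.ρbL J.liftPolar r))
  have h4 : IsLocalDiffeomorphAt 𝓘(ℝ, ℝ × ℝ × ℝ × ℝ) 𝓘(ℝ, 𝔼 4) ∞ (physX J.hε J.hε2)
      (addConstDiffeo ((J.nj, J.yh, 0, 0) : ℝ × ℝ × ℝ × ℝ) (Lin (cornerMap J.cL J.p₁ J.ρbL J.liftPolar r))) := by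
    rw [← hAff]
    have him : |(((W : ℝ) : ℂ) * exp (r.2.1 * I)).im| ≤ 1 := by
      refine (Complex.abs_im_le_norm _).trans ?_
      rw [norm_mul, norm_exp_ofReal_mul_I, mul_one, norm_real, Real.norm_of_nonneg (by linarith)]
      exact hW1
    have habs := abs_le.1 him
    have hπ := Real.pi_gt_three
    refine isLocalDiffeomorphAt_physX' J.hε J.hε2 ?_ ?_ ?_ ?_
    · show 0 < 1 + E * bxH
      rw [bxH]; linarith
    · show 1 + E * bxH < 3 / 2
      rw [bxH]; nlinarith
    · show 0 < J.yh + (((W : ℝ) : ℂ) * exp (r.2.1 * I)).im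
      rw [hyh, cY]; linarith [habs.1]
    · show J.yh + (((W : ℝ) : ℂ) * exp (r.2.1 * I)).im < 2 * π
      rw [hyh, cY]; linarith [habs.2]
  have h := ((h1'.comp (K := 𝓘(ℝ, ℝ × ℝ × ℝ × ℝ)) (P := ℝ × ℝ × ℝ × ℝ) h2).comp
    (K := 𝓘(ℝ, ℝ × ℝ × ℝ × ℝ)) (P := ℝ × ℝ × ℝ × ℝ) h3).comp (K := 𝓘(ℝ, 𝔼 4)) (P := (fishNu J.hε J.hε2).Surgered) h4
  refine isLocalDiffeomorphAt_congr_nhds' h (Eventually.of_forall fun r' ↦ ?_)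
  show J.cornerF r' = _
  rw [cornerF, hAff]
  rfl

/-- **`pmap` is a local diffeomorphism** at `(e, n, ℓ, s)` with `e < 1`, `|s - 1| < 1/4`. [folklore] -/
theorem isLocalDiffeomorphAt_pmap {q : ℝ × ℝ × ℝ × ℝ} (he : q.1 < 1) (hs : q.2.2.2 ∈ Ioo (3 / 4 : ℝ) (5 / 4)) :
    IsLocalDiffeomorphAt 𝓘(ℝ, ℝ × ℝ × ℝ × ℝ) 𝓘(ℝ, ℂ × ℝ × ℝ) ∞ J.pmap q := by
  -- `pmap = K₂ ∘ graph ∘ K₁`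
  let K₁ : (ℝ × ℝ × ℝ × ℝ) ≃L[ℝ] ((ℝ × ℝ) × (ℝ × ℝ)) :=
    { toFun := fun q ↦ ((q.2.2.1, q.1), (q.2.1, q.2.2.2))
      invFun := fun p ↦ (p.1.2, p.2.1, p.1.1, p.2.2)
      map_add' := fun _ _ ↦ rfl
      map_smul' := fun _ _ ↦ rfl
      left_inv := fun _ ↦ rfl
      right_inv := fun _ ↦ rfl
      continuous_toFun := by fun_prop
      continuous_invFun := by fun_prop }
  let K₂ : ((ℝ × ℝ) × ℂ) ≃L[ℝ] (ℂ × ℝ × ℝ) :=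
    { toFun := fun p ↦ (p.2, p.1.1, p.1.2)
      invFun := fun p ↦ ((p.2.1, p.2.2), p.1)
      map_add' := fun _ _ ↦ rfl
      map_smul' := fun _ _ ↦ rfl
      left_inv := fun _ ↦ rfl
      right_inv := fun _ ↦ rfl
      continuous_toFun := by fun_prop
      continuous_invFun := by fun_prop }
  -- the graph function
  set g : (ℝ × ℝ) × (ℝ × ℝ) → ℂ := fun p ↦
    ((p.2.1 - J.nj : ℝ) : ℂ) + (((1 - p.1.2) * bxH * Real.tan (2 * π * (p.2.2 - 1)) : ℝ) : ℂ) * I with hg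
  have hU : IsOpen {p : (ℝ × ℝ) × (ℝ × ℝ) | p.2.2 ∈ Ioo (3 / 4 : ℝ) (5 / 4)} :=
    isOpen_Ioo.preimage (continuous_snd.comp continuous_snd)
  have hcos : ∀ s ∈ Ioo (3 / 4 : ℝ) (5 / 4), Real.cos (2 * π * (s - 1)) ≠ 0 := fun s hs' ↦ by
    refine (Real.cos_pos_of_mem_Ioo ⟨?_, ?_⟩).ne' <;> nlinarith [hs'.1, hs'.2, Real.pi_pos]
  have htan : ∀ s ∈ Ioo (3 / 4 : ℝ) (5 / 4), ContDiffAt ℝ ∞ (fun s : ℝ ↦ Real.tan (2 * π * (s - 1))) s := fun s hs' ↦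
    ContDiffAt.comp (g := Real.tan) (f := fun s : ℝ ↦ 2 * π * (s - 1)) s (Real.contDiffAt_tan.2 (hcos s hs'))
      (contDiffAt_const.mul (contDiffAt_id.sub contDiffAt_const))
  have hgd : ContDiffOn ℝ ∞ g {p : (ℝ × ℝ) × (ℝ × ℝ) | p.2.2 ∈ Ioo (3 / 4 : ℝ) (5 / 4)} := by
    intro p hp
    refine ContDiffAt.contDiffWithinAt ?_
    have h1 : ContDiffAt ℝ ∞ (fun p : (ℝ × ℝ) × (ℝ × ℝ) ↦ ((p.2.1 - J.nj : ℝ) : ℂ)) p :=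
      ofRealCLM.contDiff.contDiffAt.comp p ((contDiffAt_fst.comp p contDiffAt_snd).sub contDiffAt_const)
    have h2 : ContDiffAt ℝ ∞ (fun p : (ℝ × ℝ) × (ℝ × ℝ) ↦ (1 - p.1.2) * bxH * Real.tan (2 * π * (p.2.2 - 1))) p :=
      ((contDiffAt_const.sub (contDiffAt_snd.comp p contDiffAt_fst)).mul contDiffAt_const).mul
        (ContDiffAt.comp (g := fun s : ℝ ↦ Real.tan (2 * π * (s - 1))) (f := fun p : (ℝ × ℝ) × (ℝ × ℝ) ↦ p.2.2) p
          (htan p.2.2 hp) (contDiffAt_snd.comp p contDiffAt_snd))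
    exact h1.add ((ofRealCLM.contDiff.contDiffAt.comp p h2).mul contDiffAt_const)
  -- partial derivatives in `(n, s)`
  set A : ℝ := (1 - q.1) * bxH * (1 / Real.cos (2 * π * (q.2.2.2 - 1)) ^ 2 * (2 * π)) with hA
  have hA0 : A ≠ 0 := by
    have h1 : 0 < 1 - q.1 := by linarith
    have h2 := bxH_pos
    have h3 : 0 < 1 / Real.cos (2 * π * (q.2.2.2 - 1)) ^ 2 * (2 * π) := by
      have := hcos q.2.2.2 hs; positivity
    positivity
  have hD : (1 : ℂ).re * (((A : ℝ) : ℂ) * I).im - (1 : ℂ).im * (((A : ℝ) : ℂ) * I).re ≠ 0 := by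
    simpa using hA0
  have hu : HasDerivAt (fun a : ℝ ↦ g ((K₁ q).1, (a, (K₁ q).2.2))) 1 (K₁ q).2.1 := by
    simp only [hg, K₁]
    have h := ((hasDerivAt_id (q.2.1)).sub_const J.nj).ofReal_comp.add_const
      ((((1 - q.1) * bxH * Real.tan (2 * π * (q.2.2.2 - 1)) : ℝ) : ℂ) * I)
    simpa using h
  have hv : HasDerivAt (fun b : ℝ ↦ g ((K₁ q).1, ((K₁ q).2.1, b))) (((A : ℝ) : ℂ) * I) (K₁ q).2.2 := by
    simp only [hg, K₁]
    have ht : HasDerivAt (fun b : ℝ ↦ Real.tan (2 * π * (b - 1))) (1 / Real.cos (2 * π * (q.2.2.2 - 1)) ^ 2 * (2 * π)) q.2.2.2 := by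
      have hin : HasDerivAt (fun b : ℝ ↦ 2 * π * (b - 1)) (2 * π) q.2.2.2 := by
        simpa using ((hasDerivAt_id q.2.2.2).sub_const 1).const_mul (2 * π)
      exact (Real.hasDerivAt_tan (hcos q.2.2.2 hs)).comp q.2.2.2 hin
    have h2 : HasDerivAt (fun b : ℝ ↦ (1 - q.1) * bxH * Real.tan (2 * π * (b - 1))) A q.2.2.2 := by
      rw [hA]; exact ht.const_mul _
    have h3 := (h2.ofReal_comp.mul_const I).const_add (((q.2.1 - J.nj : ℝ) : ℂ))
    simpa using h3
  have hdiff : DifferentiableAt ℝ (fun x : ℝ × ℝ ↦ g ((K₁ q).1, x)) (K₁ q).2 := by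
    have hq' : K₁ q ∈ {p : (ℝ × ℝ) × (ℝ × ℝ) | p.2.2 ∈ Ioo (3 / 4 : ℝ) (5 / 4)} := hs
    have h := (hgd.contDiffAt (hU.mem_nhds hq')).differentiableAt (by simp)
    exact h.comp (K₁ q).2 ((differentiableAt_const _).prodMk differentiableAt_id)
  have hB : HasFDerivAt (fun x : ℝ × ℝ ↦ g ((K₁ q).1, x)) (pair2Equiv 1 (((A : ℝ) : ℂ) * I) hD : ℝ × ℝ →L[ℝ] ℂ) (K₁ q).2 := by
    rw [coe_pair2Equiv]
    exact hasFDerivAt_of_partials hdiff hu hv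
  have hG : IsLocalDiffeomorphAt 𝓘(ℝ, (ℝ × ℝ) × (ℝ × ℝ)) 𝓘(ℝ, (ℝ × ℝ) × ℂ) ∞ (fun p ↦ (p.1, g p)) (K₁ q) :=
    isLocalDiffeomorphAt_graph hU hs hgd (by exact_mod_cast le_top) _ hB
  have hK₁ := K₁.toDiffeomorph.isLocalDiffeomorph q
  have hK₂ := K₂.toDiffeomorph.isLocalDiffeomorph ((K₁ q).1, g (K₁ q))
  have h := (hK₁.comp (K := 𝓘(ℝ, (ℝ × ℝ) × ℂ)) (P := (ℝ × ℝ) × ℂ) hG).comp (K := 𝓘(ℝ, ℂ × ℝ × ℝ)) (P := ℂ × ℝ × ℝ) hK₂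
  refine isLocalDiffeomorphAt_congr_nhds' h (Eventually.of_forall fun q' ↦ ?_)
  rfl

/-- **The corner is a local diffeomorphism** at a model point `mexp q` with `0 < e < E₁ < 1`,
`|s - 1| < 1/4`, principal angle in `(-π, π)`, `0 < ‖p₀‖ < 1`. [folklore] -/
theorem isLocalDiffeomorphAt_cornerP_mexp (hE : 0 < J.E₁) (hE1 : J.E₁ < 1) (hc : 0 < J.cL) (hp₁ : 0 < J.p₁)
    (hw : 0 < J.wS) (h1 : J.wS < J.rΛ₁) (h12 : J.rΛ₁ < J.rΛ₂) (hyh : J.yh = cY) (hρb : J.ρbL ≤ 1)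
    {q : ℝ × ℝ × ℝ × ℝ} (hlo : -5 < J.cL * (‖J.p0fun q‖ - J.ρbL)) (h0 : 0 < q.1) (h1' : q.1 < J.E₁)
    (hs : q.2.2.2 ∈ Ioo (3 / 4 : ℝ) (5 / 4)) (hn : q.2.1 + J.θ₀ - J.nj ∈ Ioo (-π) π) (hp : J.p0fun q ≠ 0)
    (hp1 : ‖J.p0fun q‖ < 1) :
    IsLocalDiffeomorphAt (ModelWithCorners.prod 𝓣 𝓘(ℝ, ℝ)) 𝓘(ℝ, 𝔼 4) ∞ (fun p : ThreeTorus × ℝ ↦ J.cornerP p.1 p.2) (J.mexp q) := by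
  have hmq := isLocalDiffeomorphAt_modelExp (θ₀ := J.θ₀) (nj := J.nj) hE h0 h1'
  refine isLocalDiffeomorphAt_of_comp_left hmq ?_
  have hpm := J.isLocalDiffeomorphAt_pmap (by linarith) hs
  have hF : IsLocalDiffeomorphAt 𝓘(ℝ, ℝ × ℝ × ℝ × ℝ) 𝓘(ℝ, 𝔼 4) ∞ J.cornerF (id ‖(J.pmap q).1‖, arg (J.pmap q).1, (J.pmap q).2) :=
    J.isLocalDiffeomorphAt_cornerF hc hp₁ hw h1 h12 hyh hρb (by simpa [pmap] using hlo) (by simpa [pmap] using hp)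
      (by simpa [pmap] using hp1.le) (by simpa [pmap] using h0.le) (by simp only [pmap]; linarith)
  have hR := isLocalDiffeomorphAt_radialForm (pos := id) (F := J.cornerF) (J := 𝓘(ℝ, 𝔼 4)) (fun n ϑ w ↦ J.cornerF_add_two_pi n ϑ w)
    (q := J.pmap q) (by exact hp) (Eventually.of_forall fun _ ↦ contDiffAt_id) (by simp) hF
  have h := hpm.comp (K := 𝓘(ℝ, 𝔼 4)) (P := (fishNu J.hε J.hε2).Surgered) hR
  refine isLocalDiffeomorphAt_congr_nhds' h ?_
  -- the identity `cornerP ∘ mexp = radialForm id cornerF ∘ pmap` near `q`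
  have hev1 : ∀ᶠ q' : ℝ × ℝ × ℝ × ℝ in 𝓝 q, q'.2.1 + J.θ₀ - J.nj ∈ Ioo (-π) π := by
    have hc' : Continuous fun q' : ℝ × ℝ × ℝ × ℝ ↦ q'.2.1 + J.θ₀ - J.nj := by fun_prop
    exact (isOpen_Ioo.preimage hc').mem_nhds hn
  have hev2 : ∀ᶠ q' : ℝ × ℝ × ℝ × ℝ in 𝓝 q, q'.1 ∈ Ioo 0 J.E₁ := (isOpen_Ioo.preimage continuous_fst).mem_nhds ⟨h0, h1'⟩
  filter_upwards [hev1, hev2] with q' h1'' h2'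
  exact J.cornerP_mexp hE h2'.1.le h2'.2.le ⟨h1''.1, h1''.2.le⟩

/-- **The corner is a local diffeomorphism** at `(x, s)` in the model end with `|s - 1| < 1/4`,
`z₂ ≠ -1`, `0 < ‖p₀‖ < 1`. [folklore] -/
theorem isLocalDiffeomorphAt_cornerP (hE : 0 < J.E₁) (hE1 : J.E₁ < 1) (hc : 0 < J.cL) (hp₁ : 0 < J.p₁)
    (hw : 0 < J.wS) (h1 : J.wS < J.rΛ₁) (h12 : J.rΛ₁ < J.rΛ₂) (hyh : J.yh = cY) (hρb : J.ρbL ≤ 1)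
    {x : ThreeTorus} {s : ℝ} (hlo : -5 < J.cL * (‖J.holeP0 x s‖ - J.ρbL)) (hx : 0 < (x.1 : ℂ).im)
    (hs : s ∈ Ioo (3 / 4 : ℝ) (5 / 4)) (hz : (x.2.1 : ℂ) ∈ slitPlane) (hp : J.holeP0 x s ≠ 0) (hp1 : ‖J.holeP0 x s‖ < 1) :
    IsLocalDiffeomorphAt (ModelWithCorners.prod 𝓣 𝓘(ℝ, ℝ)) 𝓘(ℝ, 𝔼 4) ∞ (fun p : ThreeTorus × ℝ ↦ J.cornerP p.1 p.2) (x, s) := by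
  obtain ⟨hq, h0, h1'⟩ := modelExp_of_im_pos (θ₀ := J.θ₀) (nj := J.nj) hE hx s
  have harg : arg (x.2.1 : ℂ) < π := lt_of_le_of_ne (arg_le_pi _) (mem_slitPlane_iff_arg.1 hz).1
  have hn : (arg (x.2.1 : ℂ) - J.θ₀ + J.nj) + J.θ₀ - J.nj ∈ Ioo (-π) π := by
    constructor <;> linarith [neg_pi_lt_arg (x.2.1 : ℂ)]
  have hp0 : J.holeP0 x s = J.p0fun (J.E₁ * (1 - (x.1 : ℂ).re) / 2, arg (x.2.1 : ℂ) - J.θ₀ + J.nj, arg (x.2.2 : ℂ), s) := by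
    have h := J.holeP0_mexp hE (q := (J.E₁ * (1 - (x.1 : ℂ).re) / 2, arg (x.2.1 : ℂ) - J.θ₀ + J.nj, arg (x.2.2 : ℂ), s))
      h0.le h1'.le ⟨hn.1, hn.2.le⟩
    rw [mexp, hq] at h
    exact h
  have h := J.isLocalDiffeomorphAt_cornerP_mexp hE hE1 hc hp₁ hw h1 h12 hyh hρb
    (q := (J.E₁ * (1 - (x.1 : ℂ).re) / 2, arg (x.2.1 : ℂ) - J.θ₀ + J.nj, arg (x.2.2 : ℂ), s)) (by rw [← hp0]; exact hlo) h0 h1'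
    hs hn (by rw [← hp0]; exact hp) (by rw [← hp0]; exact hp1)
  rwa [mexp, hq] at h

end IotaData

end CornerWindow

/-! ### The hole window -/

section HoleWindow

variable {c : ℝ} {S : ℂ → ℝ}

/-- **The handle identification with the depth carried along**, a diffeomorphism of `ℂ × ℝ × ℝ`:
`(p, ℓ, e) ↦ (Λ(p, ℓ), e)`. [folklore] -/
def lambdaE (hc : c ≠ 0) (hS : ContDiff ℝ ∞ S) : (ℂ × ℝ × ℝ) ≃ₘ⟮𝓘(ℝ, ℂ × ℝ × ℝ), 𝓘(ℝ, ℂ × ℝ × ℝ)⟯ (ℂ × ℝ × ℝ) where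
  toFun r := ((fishLambda c S (r.1, r.2.1)).1, (fishLambda c S (r.1, r.2.1)).2, r.2.2)
  invFun r := ((fishLambdaInv c S (r.1, r.2.1)).1, (fishLambdaInv c S (r.1, r.2.1)).2, r.2.2)
  left_inv r := by
    have h := fishLambdaInv_fishLambda (S := S) hc (r.1, r.2.1)
    simp only [Prod.mk.eta] at h ⊢
    rw [h]
  right_inv r := by
    have h := fishLambda_fishLambdaInv (S := S) hc (r.1, r.2.1)
    simp only [Prod.mk.eta] at h ⊢
    rw [h]
  contMDiff_toFun := by
    refine contMDiff_iff_contDiff.2 (contDiff_iff_contDiffAt.2 fun r ↦ ?_)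
    have h : ContDiffAt ℝ ∞ (fun r : ℂ × ℝ × ℝ ↦ fishLambda c S (r.1, r.2.1)) r :=
      (contDiffAt_fishLambda (c := c) hS.contDiffAt).comp r (contDiffAt_fst.prodMk (contDiffAt_fst.comp r contDiffAt_snd))
    exact (contDiffAt_fst.comp r h).prodMk ((contDiffAt_snd.comp r h).prodMk (contDiffAt_snd.comp r contDiffAt_snd))
  contMDiff_invFun := by
    refine contMDiff_iff_contDiff.2 (contDiff_iff_contDiffAt.2 fun r ↦ ?_)
    have h : ContDiffAt ℝ ∞ (fun r : ℂ × ℝ × ℝ ↦ fishLambdaInv c S (r.1, r.2.1)) r :=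
      (contDiffAt_fishLambdaInv (c := c) hS.contDiffAt).comp r (contDiffAt_fst.prodMk (contDiffAt_fst.comp r contDiffAt_snd))
    exact (contDiffAt_fst.comp r h).prodMk ((contDiffAt_snd.comp r h).prodMk (contDiffAt_snd.comp r contDiffAt_snd))

/-- The value of `lambdaE`. [folklore] -/
theorem lambdaE_apply (hc : c ≠ 0) (hS : ContDiff ℝ ∞ S) (r : ℂ × ℝ × ℝ) :
    lambdaE hc hS r = ((fishLambda c S (r.1, r.2.1)).1, (fishLambda c S (r.1, r.2.1)).2, r.2.2) := rfl

namespace IotaData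

variable (J : IotaData)

/-- **The handle coordinates in model coordinates** (handle mode):
`(e, n, ℓ, s) ↦ (ζ, w) = (c p₀ e^{-iβ}, (ρ_b - e/c) e^{iβ})`, `β = S′(p₀) - ℓ`. [folklore] -/
def hmap (q : ℝ × ℝ × ℝ × ℝ) : ℂ × ℝ × ℝ :=
  ((fishLambda J.cL J.liftS (J.p0fun q, q.2.2.1)).1,
    (polarC (J.ρbL - q.1 / J.cL, (fishLambda J.cL J.liftS (J.p0fun q, q.2.2.1)).2)).re,
    (polarC (J.ρbL - q.1 / J.cL, (fishLambda J.cL J.liftS (J.p0fun q, q.2.2.1)).2)).im)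

/-- **The hole piece through the model chart in handle mode**: `holeP ∘ mexp = tubeD ∘ hmap`. [folklore] -/
theorem holeP_mexp (hE : 0 < J.E₁) (hc : J.cL ≠ 0) (hp₁ : 0 < J.p₁) {q : ℝ × ℝ × ℝ × ℝ} (h0 : 0 ≤ q.1) (h1 : q.1 ≤ J.E₁)
    (hn : q.2.1 + J.θ₀ - J.nj ∈ Ioc (-π) π) (hhandle : ‖J.p0fun q‖ - J.ρbL + q.1 / J.cL ≤ -J.p₁) :
    J.holeP (J.mexp q).1 q.2.2.2 = J.tubeD (J.hmap q) := by
  have hp0 := J.holeP0_mexp hE h0 h1 hn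
  have hW : (J.bendWE (J.mexp q).1 q.2.2.2).1 = J.ρbL - q.1 / J.cL := by
    rw [bendWE, hp0, J.depth_mexp hE h0 h1, fishBend_of_le hc hp₁ (by exact hhandle)]
  rw [holeP, hmap]
  congr 1
  have hζ : J.holeZeta (J.mexp q).1 q.2.2.2 = (fishLambda J.cL J.liftS (J.p0fun q, q.2.2.1)).1 := by
    rw [holeZeta, hp0, modelExp_fst_snd_snd, fishLambda, Circle.coe_exp, Circle.coe_exp]
    simp only
    rw [mul_assoc, ← Complex.exp_add]
    congr 2
    push_cast
    ring
  have hw : J.holeW (J.mexp q).1 q.2.2.2 = polarC (J.ρbL - q.1 / J.cL, (fishLambda J.cL J.liftS (J.p0fun q, q.2.2.1)).2) := by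
    rw [holeW, hW, hp0, modelExp_fst_snd_snd, fishLambda, polarC, ← Circle.exp_neg, Circle.coe_exp, Circle.coe_exp]
    simp only
    rw [mul_assoc, ← Complex.exp_add]
    congr 2
    push_cast
    ring
  rw [hζ, hw]

/-- **`hmap` is a local diffeomorphism** at `(e, n, ℓ, s)` with `e < 1`, `|s - 1| < 1/4`,
`ρ_b - e/c ≠ 0` (`c ≠ 0`, `S′` smooth). [folklore] -/
theorem isLocalDiffeomorphAt_hmap (hc : J.cL ≠ 0) (hw : 0 < J.wS) (h1 : J.wS < J.rΛ₁) (h12 : J.rΛ₁ < J.rΛ₂)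
    {q : ℝ × ℝ × ℝ × ℝ} (he : q.1 < 1) (hs : q.2.2.2 ∈ Ioo (3 / 4 : ℝ) (5 / 4)) (hW : J.ρbL - q.1 / J.cL ≠ 0) :
    IsLocalDiffeomorphAt 𝓘(ℝ, ℝ × ℝ × ℝ × ℝ) 𝓘(ℝ, ℂ × ℝ × ℝ) ∞ J.hmap q := by
  have hS := J.contDiff_liftS hw h1 h12
  have h1' := J.isLocalDiffeomorphAt_pmap he hs
  have h2 := (lambdaE (S := J.liftS) hc hS).isLocalDiffeomorph (J.pmap q)
  -- the affine map `(ζ, β, e) ↦ (ζ, (ρ_b - e/c, β))`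
  let Lin : (ℂ × ℝ × ℝ) ≃L[ℝ] (ℂ × (ℝ × ℝ)) :=
    { toFun := fun r ↦ (r.1, (-(J.cL⁻¹) * r.2.2, r.2.1))
      invFun := fun r ↦ (r.1, r.2.2, -J.cL * r.2.1)
      map_add' := fun a b ↦ by simp; ring
      map_smul' := fun k a ↦ by simp; ring
      left_inv := fun r ↦ by
        obtain ⟨ζ, β, e⟩ := r
        simp only [Prod.mk.injEq, true_and]
        field_simp
      right_inv := fun r ↦ by
        obtain ⟨ζ, ρ, β⟩ := r
        simp only [Prod.mk.injEq, true_and, and_true]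
        field_simp
      continuous_toFun := by fun_prop
      continuous_invFun := by fun_prop }
  set v₀ : ℂ × (ℝ × ℝ) := (0, (J.ρbL, 0)) with hv₀
  set r₁ := lambdaE (S := J.liftS) hc hS (J.pmap q) with hr₁
  have h3 := Lin.toDiffeomorph.isLocalDiffeomorph r₁
  have h4 := (addConstDiffeo v₀).isLocalDiffeomorph (Lin r₁)
  have hpt : addConstDiffeo v₀ (Lin r₁) = (r₁.1, (J.ρbL - r₁.2.2 / J.cL, r₁.2.1)) := by
    simp [Lin, hv₀]; ring
  have h5 : IsLocalDiffeomorphAt 𝓘(ℝ, ℂ × (ℝ × ℝ)) 𝓘(ℝ, ℂ × ℂ) ∞ (fun r : ℂ × (ℝ × ℝ) ↦ (r.1, polarC r.2))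
      (addConstDiffeo v₀ (Lin r₁)) := by
    rw [hpt]
    refine isLocalDiffeomorphAt_polarGraph ?_
    show J.ρbL - r₁.2.2 / J.cL ≠ 0
    rw [hr₁, lambdaE_apply]
    exact hW
  let Fin : (ℂ × ℂ) ≃L[ℝ] (ℂ × ℝ × ℝ) :=
    { toFun := fun r ↦ (r.1, r.2.re, r.2.im)
      invFun := fun r ↦ (r.1, (r.2.1 : ℂ) + (r.2.2 : ℂ) * I)
      map_add' := fun a b ↦ by simp
      map_smul' := fun k a ↦ by simp
      left_inv := fun r ↦ by simp [Complex.re_add_im]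
      right_inv := fun r ↦ by simp
      continuous_toFun := by fun_prop
      continuous_invFun := by fun_prop }
  have h6 := Fin.toDiffeomorph.isLocalDiffeomorph ((addConstDiffeo v₀ (Lin r₁)).1, polarC (addConstDiffeo v₀ (Lin r₁)).2)
  have h := ((((h1'.comp (K := 𝓘(ℝ, ℂ × ℝ × ℝ)) (P := ℂ × ℝ × ℝ) h2).comp (K := 𝓘(ℝ, ℂ × (ℝ × ℝ))) (P := ℂ × (ℝ × ℝ)) h3).comp
    (K := 𝓘(ℝ, ℂ × (ℝ × ℝ))) (P := ℂ × (ℝ × ℝ)) h4).comp (K := 𝓘(ℝ, ℂ × ℂ)) (P := ℂ × ℂ) h5).comp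
    (K := 𝓘(ℝ, ℂ × ℝ × ℝ)) (P := ℂ × ℝ × ℝ) h6
  refine isLocalDiffeomorphAt_congr_nhds' h (Eventually.of_forall fun q' ↦ ?_)
  simp only [hmap, comp_apply, lambdaE_apply, pmap]
  simp [Lin, Fin, hv₀]
  constructor <;> ring_nf

/-- **The hole piece is a local diffeomorphism** at a model point `mexp q` in handle mode
(`‖p₀‖ - ρ_b + e/c < -p₁`), given that the tube is a local diffeomorphism at `hmap q`. [folklore] -/
theorem isLocalDiffeomorphAt_holeP_mexp (hE : 0 < J.E₁) (hE1 : J.E₁ < 1) (hc : 0 < J.cL) (hp₁ : 0 < J.p₁)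
    (hw : 0 < J.wS) (h1 : J.wS < J.rΛ₁) (h12 : J.rΛ₁ < J.rΛ₂) {q : ℝ × ℝ × ℝ × ℝ} (h0 : 0 < q.1) (h1' : q.1 < J.E₁)
    (hs : q.2.2.2 ∈ Ioo (3 / 4 : ℝ) (5 / 4)) (hn : q.2.1 + J.θ₀ - J.nj ∈ Ioo (-π) π)
    (hhandle : ‖J.p0fun q‖ - J.ρbL + q.1 / J.cL < -J.p₁)
    (hT : IsLocalDiffeomorphAt 𝓘(ℝ, ℂ × ℝ × ℝ) 𝓘(ℝ, 𝔼 4) ∞ J.tubeD (J.hmap q)) :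
    IsLocalDiffeomorphAt (ModelWithCorners.prod 𝓣 𝓘(ℝ, ℝ)) 𝓘(ℝ, 𝔼 4) ∞ (fun p : ThreeTorus × ℝ ↦ J.holeP p.1 p.2) (J.mexp q) := by
  have hmq := isLocalDiffeomorphAt_modelExp (θ₀ := J.θ₀) (nj := J.nj) hE h0 h1'
  refine isLocalDiffeomorphAt_of_comp_left hmq ?_
  have hW : J.ρbL - q.1 / J.cL ≠ 0 := by
    have := norm_nonneg (J.p0fun q); linarith
  have hhm := J.isLocalDiffeomorphAt_hmap hc.ne' hw h1 h12 (by linarith) hs hW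
  have h := hhm.comp (K := 𝓘(ℝ, 𝔼 4)) (P := (fishNu J.hε J.hε2).Surgered) hT
  refine isLocalDiffeomorphAt_congr_nhds' h ?_
  have hcont : ContinuousAt (fun q' ↦ ‖J.p0fun q'‖ - J.ρbL + q'.1 / J.cL) q := by
    have h1 : ContinuousAt J.pmap q := (J.isLocalDiffeomorphAt_pmap (by linarith) hs).contMDiffAt.continuousAt
    have h2 : ContinuousAt (fun q' ↦ ‖(J.pmap q').1‖) q := continuous_norm.continuousAt.comp (continuousAt_fst.comp h1)
    exact (h2.sub continuousAt_const).add (continuousAt_fst.div_const _)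
  have hev0 : ∀ᶠ q' in 𝓝 q, ‖J.p0fun q'‖ - J.ρbL + q'.1 / J.cL < -J.p₁ := hcont.eventually_lt continuousAt_const hhandle
  have hev1 : ∀ᶠ q' : ℝ × ℝ × ℝ × ℝ in 𝓝 q, q'.2.1 + J.θ₀ - J.nj ∈ Ioo (-π) π := by
    have hc' : Continuous fun q' : ℝ × ℝ × ℝ × ℝ ↦ q'.2.1 + J.θ₀ - J.nj := by fun_prop
    exact (isOpen_Ioo.preimage hc').mem_nhds hn
  have hev2 : ∀ᶠ q' : ℝ × ℝ × ℝ × ℝ in 𝓝 q, q'.1 ∈ Ioo 0 J.E₁ := (isOpen_Ioo.preimage continuous_fst).mem_nhds ⟨h0, h1'⟩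
  filter_upwards [hev0, hev1, hev2] with q' h0' h1'' h2'
  exact J.holeP_mexp hE hc.ne' hp₁ h2'.1.le h2'.2.le ⟨h1''.1, h1''.2.le⟩ h0'.le

end IotaData

end HoleWindow

/-! ### The glue -/

section Glue

namespace IotaData

variable (J : IotaData)

/-- **Hypotheses on the parameters for the local-diffeomorphism property of `iotaTwo`**, with a
slab half-width `δ` for the two glue radii `r_h < r_c`. [folklore] -/
structure LocHyp (δ : ℝ) : Prop where
  hE : 0 < J.E₁
  hE1 : J.E₁ ≤ 1 / 2
  hc : 0 < J.cL
  hp₁ : 0 < J.p₁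
  hw : 0 < J.wS
  hw1 : J.wS < J.rΛ₁
  h12 : J.rΛ₁ < J.rΛ₂
  hyh : J.yh = cY
  hcδ : J.cL * (J.ρbL - J.rh + δ) < 5
  hθ₀ : 0 < J.θ₀
  hθ₀' : J.θ₀ ≤ π / 2
  hδ : 0 < δ
  hrh : δ < J.rh
  hhc : J.rh + δ ≤ J.rc - δ
  hrc1 : J.rc ≤ 1
  hrcA : J.rc + δ ≤ (1 - J.E₁) * bxH * Real.tan (2 * π * (19 / 100))
  hΛ : J.rΛ₂ ≤ J.rc - δ
  hbox : J.ρbL ≤ J.rc - δ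
  hhandle : J.rh + δ + J.p₁ + J.E₁ / J.cL ≤ J.ρbL
  hs₁ : J.s₁ ≤ J.cL * (J.rh - δ)
  hs₂ : J.s₂ ≤ J.cL * (J.rh - δ)
  hs₃ : J.s₃ ≤ J.cL * (J.rh - δ)
  hs₄ : J.s₄ ≤ J.cL * (J.rh - δ)
  hs₅ : J.s₅ ≤ J.cL * (J.rh - δ)
  hs₆ : J.s₆ ≤ J.cL * (J.rh - δ)
  hs₇ : J.s₇ ≤ J.cL * (J.rh - δ)
  ha₈ : J.a₈ < J.b₈
  hb₈ : J.b₈ ≤ J.cL * (J.rh - δ)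
  hμ : ∀ r, J.cL * (J.rh - δ) ≤ r → J.μL r = 1
  ldT : ∀ r : ℂ × ℝ × ℝ, ‖r.1‖ < J.cL * (J.rh + δ) → (J.ρbL - J.E₁ / J.cL) ^ 2 < r.2.1 ^ 2 + r.2.2 ^ 2 →
    r.2.1 ^ 2 + r.2.2 ^ 2 < J.ρbL ^ 2 → IsLocalDiffeomorphAt 𝓘(ℝ, ℂ × ℝ × ℝ) 𝓘(ℝ, 𝔼 4) ∞ J.tubeD r

variable {J} {δ : ℝ}

/-- Derived: `0 ≤ ρ_b`, `E₁ < 1`, `0 < E₁ / c`. [folklore] -/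
theorem LocHyp.ρb_nonneg (H : J.LocHyp δ) : 0 ≤ J.ρbL := by
  have h1 := H.hhandle; have h2 := H.hrh; have h3 := H.hδ; have h4 := H.hp₁
  have h5 : 0 < J.E₁ / J.cL := div_pos H.hE H.hc
  linarith

/-- `E₁ < 1` from the local hypotheses. [folklore] -/
theorem LocHyp.E1_lt_one (H : J.LocHyp δ) : J.E₁ < 1 := by linarith [H.hE1]

/-- The depth of a point of the model end. [folklore] -/
theorem depth_mem (hE : 0 < J.E₁) {x : ThreeTorus} (hx : 0 < (x.1 : ℂ).im) : 0 < J.depth x.1 ∧ J.depth x.1 < J.E₁ := by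
  have h := (modelExp_of_im_pos (θ₀ := J.θ₀) (nj := J.nj) hE hx 0).2
  rw [depth]; exact ⟨by nlinarith [h.1], by nlinarith [h.2]⟩

/-- The depth is at most `E₁` everywhere (`re z₁ ≥ -1`) and nonnegative. [folklore] -/
theorem depth_le (hE : 0 < J.E₁) (z : Circle) : 0 ≤ J.depth z ∧ J.depth z ≤ J.E₁ := by
  have h1 : |(z : ℂ).re| ≤ 1 := by
    have := Complex.abs_re_le_norm (z : ℂ); rwa [z.norm_coe] at this
  obtain ⟨hl, hr⟩ := abs_le.1 h1
  rw [depth]; constructor <;> nlinarith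

/-- **The tube at a leg-window radius is the leg piece at the radius itself**
(`‖ζ‖ ≥ c (r_h - δ)`: beyond all glue radii and the leg-position blend). [folklore] -/
theorem tubeD_of_le (H : J.LocHyp δ) {r : ℂ × ℝ × ℝ} (hr : J.cL * (J.rh - δ) ≤ ‖r.1‖) :
    J.tubeD r = pieceU1 J.hε J.hε2 J.nj J.yh J.cL J.ρbL J.μL (‖r.1‖, arg r.1, r.2.1, r.2.2) := by
  rw [TubeDData.tubeD, glueBy_of_le (τ := fun q : ℂ × ℝ × ℝ ↦ ‖q.1‖) (show J.s₁ ≤ ‖r.1‖ by linarith [H.hs₁]),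
    glueBy_of_le (τ := fun q : ℂ × ℝ × ℝ ↦ ‖q.1‖) (show J.s₂ ≤ ‖r.1‖ by linarith [H.hs₂]),
    glueBy_of_le (τ := fun q : ℂ × ℝ × ℝ ↦ ‖q.1‖) (show J.s₃ ≤ ‖r.1‖ by linarith [H.hs₃]),
    glueBy_of_le (τ := fun q : ℂ × ℝ × ℝ ↦ ‖q.1‖) (show J.s₄ ≤ ‖r.1‖ by linarith [H.hs₄]),
    glueBy_of_le (τ := fun q : ℂ × ℝ × ℝ ↦ ‖q.1‖) (show J.s₅ ≤ ‖r.1‖ by linarith [H.hs₅]),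
    glueBy_of_le (τ := fun q : ℂ × ℝ × ℝ ↦ ‖q.1‖) (show J.s₆ ≤ ‖r.1‖ by linarith [H.hs₆]),
    glueBy_of_le (τ := fun q : ℂ × ℝ × ℝ ↦ ‖q.1‖) (show J.s₇ ≤ ‖r.1‖ by linarith [H.hs₇]),
    TubeDData.winU1, radialForm_apply, TubeDData.posL, blendFun_of_one (stdBlend_of_ge H.ha₈ (by linarith [H.hb₈]))]

/-- The norm of the disc coordinate: `‖ζ‖ = c ‖p₀‖`. [folklore] -/
theorem norm_holeZeta (hc : 0 < J.cL) (x : ThreeTorus) (s : ℝ) : ‖J.holeZeta x s‖ = J.cL * ‖J.holeP0 x s‖ := by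
  rw [holeZeta, norm_mul, norm_mul, norm_mul, Circle.norm_coe, Circle.norm_coe, mul_one, mul_one, norm_real,
    Real.norm_of_nonneg hc.le]

/-- **Off the flat sector the hole coordinate is large**: for `0.19 < |s - 1| < 1/5`,
`‖p₀‖ ≥ |im p₀| ≥ (1 - E₁) h tan (2π · 0.19)`. [folklore] -/
theorem norm_holeP0_ge (hE : 0 < J.E₁) (hE1 : J.E₁ < 1) {x : ThreeTorus} {s : ℝ} (hs : |s - 1| < 1 / 5)
    (h19 : 19 / 100 < |s - 1|) : (1 - J.E₁) * bxH * Real.tan (2 * π * (19 / 100)) ≤ ‖J.holeP0 x s‖ := by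
  have hd := J.depth_le hE x.1
  have him : (J.holeP0 x s).im = (1 - J.depth x.1) * bxH * Real.tan (2 * π * (s - 1)) := by
    rw [holeP0, add_im, ofReal_im, mul_im, ofReal_re, ofReal_im, I_re, I_im]; ring
  have htan : Real.tan (2 * π * (19 / 100)) < |Real.tan (2 * π * (s - 1))| := by
    have hπ := Real.pi_pos
    have hlt : 2 * π * (19 / 100) < 2 * π * |s - 1| := by nlinarith
    have hub : 2 * π * |s - 1| < π / 2 := by nlinarith [hs]
    have h1 := Real.tan_lt_tan_of_lt_of_lt_pi_div_two (by nlinarith) hub hlt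
    rcases abs_cases (s - 1) with ⟨habs, _⟩ | ⟨habs, _⟩
    · rw [habs] at h1; exact h1.trans_le (le_abs_self _)
    · rw [habs, show 2 * π * (-(s - 1)) = -(2 * π * (s - 1)) by ring, Real.tan_neg] at h1
      exact h1.trans_le (neg_le_abs _)
  have h1e : 1 - J.E₁ ≤ 1 - J.depth x.1 := by linarith [hd.2]
  have hpos : 0 < Real.tan (2 * π * (19 / 100)) := Real.tan_pos_of_pos_of_lt_pi_div_two (by positivity) (by nlinarith [Real.pi_pos])
  have h0 : 0 ≤ (1 - J.depth x.1) * bxH := by nlinarith [hd.2, bxH_pos]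
  have key : (1 - J.E₁) * bxH * Real.tan (2 * π * (19 / 100)) ≤ |(J.holeP0 x s).im| := by
    rw [him, abs_mul, abs_of_nonneg h0]
    calc (1 - J.E₁) * bxH * Real.tan (2 * π * (19 / 100))
        ≤ (1 - J.depth x.1) * bxH * Real.tan (2 * π * (19 / 100)) :=
          mul_le_mul_of_nonneg_right (mul_le_mul_of_nonneg_right h1e bxH_pos.le) hpos.le
      _ ≤ (1 - J.depth x.1) * bxH * |Real.tan (2 * π * (s - 1))| := mul_le_mul_of_nonneg_left htan.le h0
  exact key.trans (Complex.abs_im_le_norm _)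

/-- **Far from the hole angle the hole coordinate is large**: if `re (z₂ e^{-iθ₀}) < 1/2` then
`‖p₀‖ ≥ |re p₀| = |arg z₂ - θ₀| > π/3`. [folklore] -/
theorem norm_holeP0_gt_of_re_lt {x : ThreeTorus} (h : ((x.2.1 : ℂ) * exp (-(J.θ₀ * I))).re < 1 / 2) (s : ℝ) :
    π / 3 < ‖J.holeP0 x s‖ := by
  rw [re_mul_exp_neg] at h
  have hre : (J.holeP0 x s).re = arg (x.2.1 : ℂ) - J.θ₀ := by
    rw [holeP0, add_re, ofReal_re, mul_re, ofReal_re, ofReal_im, I_re, I_im, lat]; ring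
  have habs : π / 3 < |arg (x.2.1 : ℂ) - J.θ₀| := by
    by_contra hle
    rw [not_lt] at hle
    have h1 := Real.cos_le_cos_of_nonneg_of_le_pi (abs_nonneg _) (by linarith [Real.pi_pos]) hle
    rw [Real.cos_abs, Real.cos_pi_div_three] at h1
    linarith
  calc π / 3 < |(J.holeP0 x s).re| := by rw [hre]; exact habs
    _ ≤ ‖J.holeP0 x s‖ := Complex.abs_re_le_norm _

/-- **The window agreements on the slabs**: hole = corner on `|‖p₀‖ - r_h| < δ`, corner = box on
`|‖p₀‖ - r_c| < δ` (the latter for `|s - 1| < 1/5`). [folklore] -/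
theorem holeP_eq_cornerP_of (H : J.LocHyp δ) {x : ThreeTorus} {s : ℝ} (h : |‖J.holeP0 x s‖ - J.rh| < δ) :
    J.holeP x s = J.cornerP x s := by
  obtain ⟨hl, hr⟩ := abs_lt.1 h
  have hd := J.depth_le H.hE x.1
  have hp : J.holeP0 x s ≠ 0 := by
    rw [← norm_pos_iff]; linarith [H.hrh]
  have hec : J.depth x.1 / J.cL ≤ J.E₁ / J.cL := div_le_div_of_nonneg_right hd.2 H.hc.le
  refine J.holeP_eq_cornerP H.hc H.hp₁ hp (by linarith [H.hhandle]) (fun a b ↦ ?_) ?_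
  · have hn : J.cL * (J.rh - δ) ≤ ‖J.holeZeta x s‖ := by
      rw [J.norm_holeZeta H.hc]; exact mul_le_mul_of_nonneg_left (by linarith) H.hc.le
    exact J.tubeD_of_le H (r := (J.holeZeta x s, a, b)) hn
  · refine H.hμ _ ?_
    rw [J.norm_holeZeta H.hc]; exact mul_le_mul_of_nonneg_left (by linarith) H.hc.le

/-- The corner is the box shell on the corner–box junction (local hypotheses version). [folklore] -/
theorem cornerP_eq_boxP_of (H : J.LocHyp δ) {x : ThreeTorus} {s : ℝ} (hs : |s - 1| < 1 / 5)
    (h : |‖J.holeP0 x s‖ - J.rc| < δ) : J.cornerP x s = J.boxP x s := by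
  obtain ⟨hl, hr⟩ := abs_lt.1 h
  have hd := J.depth_le H.hE x.1
  have hp : J.holeP0 x s ≠ 0 := by
    rw [← norm_pos_iff]; linarith [H.hrh, H.hhc, H.hδ]
  -- the flat sector: otherwise `‖p₀‖ ≥ (1 - E₁) h tan (2π · 0.19) ≥ r_c + δ`
  have hs19 : |s - 1| ≤ 19 / 100 := by
    by_contra h19
    have := J.norm_holeP0_ge H.hE H.E1_lt_one (x := x) hs (not_le.1 h19)
    linarith [H.hrcA]
  have hec : 0 ≤ J.depth x.1 / J.cL := div_nonneg hd.1 H.hc.le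
  exact J.cornerP_eq_boxP H.h12 H.hp₁ H.hyh hs19 (by linarith [hd.2, H.hE1]) hp (by linarith [H.hΛ]) (by linarith [H.hbox])

/-- `re² + im²` of the polar map is the radius squared. [folklore] -/
theorem polarC_sq (X b : ℝ) : (polarC (X, b)).re ^ 2 + (polarC (X, b)).im ^ 2 = X ^ 2 := by
  have h : ‖polarC (X, b)‖ = |X| := by
    rw [polarC]; simp [norm_exp_ofReal_mul_I]
  have h2 : (polarC (X, b)).re ^ 2 + (polarC (X, b)).im ^ 2 = ‖polarC (X, b)‖ ^ 2 := by
    rw [Complex.sq_norm, Complex.normSq_apply]; ring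
  rw [h2, h, sq_abs]

/-- **The hole piece is a local diffeomorphism** at `(x, s)` in the model end with `|s - 1| < 1/5`,
`z₂ ≠ -1`, `‖p₀‖ < r_h` (under `LocHyp`). [folklore] -/
theorem isLocalDiffeomorphAt_holeP (H : J.LocHyp δ) {x : ThreeTorus} {s : ℝ} (hx : 0 < (x.1 : ℂ).im)
    (hs : s ∈ Ioo (3 / 4 : ℝ) (5 / 4)) (hz : (x.2.1 : ℂ) ∈ slitPlane) (hτ : ‖J.holeP0 x s‖ < J.rh) :
    IsLocalDiffeomorphAt (ModelWithCorners.prod 𝓣 𝓘(ℝ, ℝ)) 𝓘(ℝ, 𝔼 4) ∞ (fun p : ThreeTorus × ℝ ↦ J.holeP p.1 p.2) (x, s) := by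
  obtain ⟨hq, h0, h1'⟩ := modelExp_of_im_pos (θ₀ := J.θ₀) (nj := J.nj) H.hE hx s
  set q : ℝ × ℝ × ℝ × ℝ := (J.E₁ * (1 - (x.1 : ℂ).re) / 2, arg (x.2.1 : ℂ) - J.θ₀ + J.nj, arg (x.2.2 : ℂ), s) with hqdef
  have harg : arg (x.2.1 : ℂ) < π := lt_of_le_of_ne (arg_le_pi _) (mem_slitPlane_iff_arg.1 hz).1
  have hn : (arg (x.2.1 : ℂ) - J.θ₀ + J.nj) + J.θ₀ - J.nj ∈ Ioo (-π) π := by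
    constructor <;> linarith [neg_pi_lt_arg (x.2.1 : ℂ)]
  have hp0 : J.holeP0 x s = J.p0fun q := by
    have h := J.holeP0_mexp H.hE (q := q) h0.le h1'.le ⟨hn.1, hn.2.le⟩
    rw [mexp, hq] at h
    exact h
  have hec : q.1 / J.cL < J.E₁ / J.cL := div_lt_div_of_pos_right h1' H.hc
  have hhandle : ‖J.p0fun q‖ - J.ρbL + q.1 / J.cL < -J.p₁ := by
    rw [← hp0]; linarith [H.hhandle, H.hδ]
  have hT : IsLocalDiffeomorphAt 𝓘(ℝ, ℂ × ℝ × ℝ) 𝓘(ℝ, 𝔼 4) ∞ J.tubeD (J.hmap q) := by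
    refine H.ldT _ ?_ ?_ ?_
    · rw [hmap, norm_fishLambda_fst, abs_of_pos H.hc, ← hp0]
      nlinarith [H.hc, H.hδ]
    · rw [hmap, polarC_sq]
      have h2 : 0 < q.1 / J.cL := div_pos h0 H.hc
      have h3 : 0 < J.ρbL - J.E₁ / J.cL := by linarith [H.hhandle, H.hrh, H.hδ, H.hp₁]
      nlinarith
    · rw [hmap, polarC_sq]
      have h2 : 0 < q.1 / J.cL := div_pos h0 H.hc
      have h3 : 0 < J.ρbL - J.E₁ / J.cL := by linarith [H.hhandle, H.hrh, H.hδ, H.hp₁]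
      nlinarith
  have h := J.isLocalDiffeomorphAt_holeP_mexp H.hE H.E1_lt_one H.hc H.hp₁ H.hw H.hw1 H.h12 (q := q) h0 h1' hs hn hhandle hT
  rwa [mexp, hq] at h

/-- **The end map on the second cylinder is a local diffeomorphism** at every point of the model
end `{im z₁ > 0}` (under `LocHyp`). [cite: GompfAGT2010, Lemma 2.2 (Φ = N ∪_γ h: the end of the fishtail neighbourhood is a collar)] -/
theorem isLocalDiffeomorphAt_iotaTwo (H : J.LocHyp δ) {x : ThreeTorus} {s : ℝ} (hx : 0 < (x.1 : ℂ).im) :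
    IsLocalDiffeomorphAt (ModelWithCorners.prod 𝓣 𝓘(ℝ, ℝ)) 𝓘(ℝ, 𝔼 4) ∞ J.iotaTwo (x, s) := by
  set τ : ThreeTorus × ℝ → ℝ := fun p ↦ J.holeDist p.1 p.2 with hτdef
  have hiota : J.iotaTwo = glueBy τ J.rh (fun p ↦ J.holeP p.1 p.2)
      (glueBy τ J.rc (fun p ↦ J.cornerP p.1 p.2) fun p ↦ J.boxP p.1 p.2) := rfl
  have hE1 := H.E1_lt_one
  have hπ := Real.pi_gt_three
  -- `w ≤ 1 ≤ π`, `cos (π - θ₀) ≤ 0 < 1/2 < cos w`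
  have hw1 : J.wS ≤ 1 := by linarith [H.hw1, H.h12, H.hΛ, H.hrc1, H.hδ]
  have hcosw : 1 / 2 < Real.cos J.wS := by
    have h1 : Real.cos (π / 3) < Real.cos J.wS :=
      Real.cos_lt_cos_of_nonneg_of_le_pi_div_two H.hw.le (by linarith) (by linarith)
    rwa [Real.cos_pi_div_three] at h1
  have hθw : Real.cos (π - J.θ₀) < Real.cos J.wS := by
    rw [Real.cos_pi_sub]
    have : 0 ≤ Real.cos J.θ₀ := Real.cos_nonneg_of_mem_Icc ⟨by linarith [H.hθ₀], H.hθ₀'⟩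
    linarith
  -- the value of `τ` is `≥ r_c` off the flat sector and far from the hole angle
  have hτ_ge : ∀ p : ThreeTorus × ℝ, (19 / 100 < |p.2 - 1| ∨ ((p.1.2.1 : ℂ) * exp (-(J.θ₀ * I))).re < 1 / 2) → J.rc ≤ τ p := by
    rintro ⟨x', s'⟩ hp
    simp only [hτdef, holeDist]
    split_ifs with h5
    · rcases hp with h19 | hre
      · have := J.norm_holeP0_ge H.hE hE1 (x := x') h5 h19; linarith [H.hrcA, H.hδ]
      · have := J.norm_holeP0_gt_of_re_lt hre s'; linarith [H.hrc1]
    · exact H.hrc1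
  by_cases hfar : 19 / 100 < |s - 1| ∨ ((x.2.1 : ℂ) * exp (-(J.θ₀ * I))).re < 1 / 2
  · -- locally the box shell
    have ho : IsOpen {p : ThreeTorus × ℝ | 19 / 100 < |p.2 - 1| ∨ ((p.1.2.1 : ℂ) * exp (-(J.θ₀ * I))).re < 1 / 2} := by
      refine IsOpen.union (isOpen_lt continuous_const (continuous_abs.comp (continuous_snd.sub continuous_const))) ?_
      exact isOpen_lt (continuous_re.comp ((continuous_subtype_val.comp
        (continuous_fst.comp (continuous_snd.comp continuous_fst))).mul continuous_const)) continuous_const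
    have hbox : IsLocalDiffeomorphAt (ModelWithCorners.prod 𝓣 𝓘(ℝ, ℝ)) 𝓘(ℝ, 𝔼 4) ∞ (fun p : ThreeTorus × ℝ ↦ J.boxP p.1 p.2) (x, s) := by
      refine J.isLocalDiffeomorphAt_boxP H.hE hE1 H.hw (by linarith) hθw hx ?_
      rcases hfar with h19 | hre
      · left; intro h1; rw [h1, sub_self, abs_zero] at h19; linarith
      · right; linarith
    rw [hiota]
    refine isLocalDiffeomorphAt_congr_nhds' hbox ?_
    filter_upwards [ho.mem_nhds (show (x, s) ∈ {p : ThreeTorus × ℝ | _} from hfar)] with p hp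
    have hge := hτ_ge p hp
    rw [glueBy_of_le (show J.rh ≤ τ p by linarith [H.hhc, H.hδ]), glueBy_of_le hge]
  · -- near the hole: the nested glue on `S`
    rw [not_or, not_lt, not_lt] at hfar
    obtain ⟨hs19, hre⟩ := hfar
    have hs5 : |s - 1| < 1 / 5 := by linarith
    have hsI : s ∈ Ioo (3 / 4 : ℝ) (5 / 4) := by
      obtain ⟨h1, h2⟩ := abs_le.1 hs19; exact ⟨by linarith, by linarith⟩
    set S : Set (ThreeTorus × ℝ) := {p | |p.2 - 1| < 1 / 5 ∧ 0 < ((p.1.2.1 : ℂ) * exp (-(J.θ₀ * I))).re} with hSdef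
    have hcre : Continuous fun p : ThreeTorus × ℝ ↦ ((p.1.2.1 : ℂ) * exp (-(J.θ₀ * I))).re :=
      continuous_re.comp ((continuous_subtype_val.comp (continuous_fst.comp (continuous_snd.comp continuous_fst))).mul
        continuous_const)
    have hS : IsOpen S := (isOpen_lt (continuous_abs.comp (continuous_snd.sub continuous_const)) continuous_const).inter
      (isOpen_lt continuous_const hcre)
    have hmem : (x, s) ∈ S := ⟨hs5, by linarith⟩
    -- on `S`, `z₂` is in the slit plane
    have hslit : ∀ p ∈ S, (p.1.2.1 : ℂ) ∈ slitPlane := fun p hp ↦ by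
      rw [mem_slitPlane_iff_arg]
      refine ⟨fun hπ' ↦ ?_, Circle.coe_ne_zero _⟩
      have h := hp.2
      rw [re_mul_exp_neg, hπ', Real.cos_pi_sub] at h
      have : 0 ≤ Real.cos J.θ₀ := Real.cos_nonneg_of_mem_Icc ⟨by linarith [H.hθ₀], H.hθ₀'⟩
      linarith
    have hz := hslit _ hmem
    -- `τ = ‖p₀‖` on `S`, continuous there
    have hτS : ContinuousOn τ S := by
      have hcont : ∀ p ∈ S, ContinuousAt (fun p : ThreeTorus × ℝ ↦ ‖J.holeP0 p.1 p.2‖) p := fun p hp ↦ by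
        have harg : ContinuousAt (fun p : ThreeTorus × ℝ ↦ arg (p.1.2.1 : ℂ)) p :=
          ContinuousAt.comp (g := arg) (f := fun p : ThreeTorus × ℝ ↦ (p.1.2.1 : ℂ)) (x := p) (continuousAt_arg (hslit p hp))
            (Continuous.continuousAt (by fun_prop))
        have hdep : Continuous fun p : ThreeTorus × ℝ ↦ J.depth p.1.1 := by
          unfold depth
          exact (continuous_const.mul (continuous_const.sub (continuous_re.comp
            (continuous_subtype_val.comp (continuous_fst.comp continuous_fst))))).div_const _
        have hcos : Real.cos (2 * π * (p.2 - 1)) ≠ 0 := by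
          have h5 : |p.2 - 1| < 1 / 5 := hp.1
          obtain ⟨h1, h2⟩ := abs_lt.1 h5
          refine (Real.cos_pos_of_mem_Ioo ⟨?_, ?_⟩).ne' <;> nlinarith [Real.pi_pos]
        have htan : ContinuousAt (fun p : ThreeTorus × ℝ ↦ Real.tan (2 * π * (p.2 - 1))) p :=
          ContinuousAt.comp (g := Real.tan) (f := fun p : ThreeTorus × ℝ ↦ 2 * π * (p.2 - 1)) (x := p)
            (Real.continuousAt_tan.2 hcos) (Continuous.continuousAt (by fun_prop))
        have hP : ContinuousAt (fun p : ThreeTorus × ℝ ↦ J.holeP0 p.1 p.2) p := by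
          unfold holeP0 lat
          refine ((Complex.continuous_ofReal.continuousAt.comp ((harg.sub continuousAt_const).add continuousAt_const |>.sub
            continuousAt_const))).add ((Complex.continuous_ofReal.continuousAt.comp ?_).mul continuousAt_const)
          exact ((continuousAt_const.sub hdep.continuousAt).mul continuousAt_const).mul htan
        exact continuous_norm.continuousAt.comp hP
      refine ContinuousOn.congr (f := fun p : ThreeTorus × ℝ ↦ ‖J.holeP0 p.1 p.2‖) (fun p hp ↦ (hcont p hp).continuousWithinAt)
        fun p hp ↦ ?_
      show J.holeDist p.1 p.2 = ‖J.holeP0 p.1 p.2‖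
      rw [holeDist, if_pos hp.1]
    have hτx : τ (x, s) = ‖J.holeP0 x s‖ := by
      show J.holeDist x s = _; rw [holeDist, if_pos hs5]
    rw [hiota]
    refine isLocalDiffeomorphAt_glueBy_of_continuousOn hS hτS H.hδ hmem (fun p hp h ↦ ?_) (fun h ↦ ?_) (fun h ↦ ?_)
    · -- hole = corner on the slab
      have hτp : τ p = ‖J.holeP0 p.1 p.2‖ := by
        show J.holeDist p.1 p.2 = _; rw [holeDist, if_pos hp.1]
      rw [hτp] at h
      rw [glueBy_of_lt (show τ p < J.rc by rw [hτp]; linarith [(abs_lt.1 h).2, H.hhc, H.hδ])]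
      exact J.holeP_eq_cornerP_of H h
    · -- the hole window
      rw [hτx] at h
      exact J.isLocalDiffeomorphAt_holeP H hx hsI hz h
    · -- the inner glue
      rw [hτx] at h
      refine isLocalDiffeomorphAt_glueBy_of_continuousOn hS hτS H.hδ hmem (fun p hp h' ↦ ?_) (fun h' ↦ ?_) (fun h' ↦ ?_)
      · have hτp : τ p = ‖J.holeP0 p.1 p.2‖ := by
          show J.holeDist p.1 p.2 = _; rw [holeDist, if_pos hp.1]
        rw [hτp] at h'
        exact J.cornerP_eq_boxP_of H hp.1 h'
      · rw [hτx] at h'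
        have hp0 : J.holeP0 x s ≠ 0 := by rw [← norm_pos_iff]; linarith [H.hrh]
        have hlo : -5 < J.cL * (‖J.holeP0 x s‖ - J.ρbL) := by
          have h1 : J.cL * (J.rh - δ - J.ρbL) < J.cL * (‖J.holeP0 x s‖ - J.ρbL) := mul_lt_mul_of_pos_left (by linarith) H.hc
          linarith [H.hcδ]
        exact J.isLocalDiffeomorphAt_cornerP H.hE hE1 H.hc H.hp₁ H.hw H.hw1 H.h12 H.hyh
          (by linarith [H.hbox, H.hδ, H.hrc1]) hlo hx hsI hz hp0 (by linarith [H.hrc1])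
      · rw [hτx] at h'
        refine J.isLocalDiffeomorphAt_boxP H.hE hE1 H.hw (by linarith) hθw hx ?_
        by_cases h1 : s = 1
        · right
          -- at `s = 1`: `p₀ = arg z₂ - θ₀` is real with `|p₀| > r_c - δ ≥ w`, and `|arg z₂ - θ₀| < π/2`
          have hp0 : J.holeP0 x s = ((arg (x.2.1 : ℂ) - J.θ₀ : ℝ) : ℂ) := by
            rw [holeP0, h1, sub_self, mul_zero, Real.tan_zero, mul_zero, ofReal_zero, zero_mul, add_zero, lat]
            push_cast; ring
          rw [hp0, norm_real, Real.norm_eq_abs] at h'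
          have hd : |arg (x.2.1 : ℂ) - J.θ₀| < π / 2 := by
            have hc0 : 0 < Real.cos (arg (x.2.1 : ℂ) - J.θ₀) := by rw [← re_mul_exp_neg]; linarith
            rw [abs_lt]
            constructor
            · by_contra hle
              rw [not_lt] at hle
              have : Real.cos (arg (x.2.1 : ℂ) - J.θ₀) ≤ 0 := by
                have h3 : -(3 * π / 2) ≤ arg (x.2.1 : ℂ) - J.θ₀ := by linarith [neg_pi_lt_arg (x.2.1 : ℂ), H.hθ₀']
                have := Real.cos_nonpos_of_pi_div_two_le_of_le (x := arg (x.2.1 : ℂ) - J.θ₀ + 2 * π) (by linarith) (by linarith)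
                rwa [Real.cos_add_two_pi] at this
              linarith
            · by_contra hle
              rw [not_lt] at hle
              have : Real.cos (arg (x.2.1 : ℂ) - J.θ₀) ≤ 0 :=
                Real.cos_nonpos_of_pi_div_two_le_of_le hle (by linarith [arg_le_pi (x.2.1 : ℂ), H.hθ₀])
              linarith
          rw [re_mul_exp_neg, ← Real.cos_abs]
          exact Real.cos_lt_cos_of_nonneg_of_le_pi_div_two H.hw.le hd.le (by linarith [H.hΛ, H.h12, H.hw1])
        · exact Or.inl h1

end IotaData

end Glue

end Literature.Topology.FourManifolds
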